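import Summits.NavierStokesRegularity.NavierStokesRegularity.Theorems.FilamentSkeletonRssBoxSelectionRJ

/-!
# R-T RETYPE KIT (director-ns dss_61 (1b), dss_64 (2)) for the selection layer of route `FilamentSkeletonRss`
# — crux workfile of `SelectionBoxRJ` (stmt-NavierStokesRegularity-21220), author ns-idea-12 g2 (planner; files only)

This file CERTIFIES the kit texts of `Lines/retype_kit.md`: the replacement decls ELABORATE, the replacement selection
glue is PROVED (no Poincaré–Miranda, no sign law), and the replacement deciding theorem `closes0` elaborates with the
conclusion `¬ NavierStokesRegularity` from the NEW open pair + the PROVED `RdssProfileTruncation` (rev-12 body of the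
route's `closes` verbatim after the first line).  MODEL rung, NEGATIVE side; nothing here bears on NS regularity (OPEN):
both new hypotheses are open cruxes, exactly as 21220/21221 were.

VARIANT A2 (minimal re-threading; RECOMMENDED for the edit): keep the tilted parameter box `p ∈ [0,1]^N` and every box
clause of the J-twins VERBATIM, and make exactly these changes, in lock-step in both decls —
 (R-T)  `SkeletonBoxJ`       := `SelectionBoxRJ` with the accretion SIGN-LAW conjunct DELETED (the box half alone);
        `TransverseReduction0` := `TransverseReductionRJ` with the multipliers DELETED: no binder `B`, no continuity of `B`,
        forced equation `… = ∑ j, B p j • D p j y` replaced by the EXACT profile equation `… = 0`; the torque modes `D`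
        (binder + defining hypothesis) are deleted from both decls (nothing refers to them any more);
 (R-μ)  the skeleton velocity `u p Z y` uses the CORE-MATCHED regularisation: kernel `((‖y-Z k σ‖^2+1)^(3/2))⁻¹` ↦
        `((‖y-Z k σ‖^2 + e^{-(1+γ_E-log 2)}·Aa p k σ)^(3/2))⁻¹` (μ_k(σ)² = (0.6427·√A_k(σ))² = 0.41307·A_k(σ); Saffman's
        Gaussian-ring constant, memo §4), with a new skeleton datum `Aa p j : ℝ → ℝ` (transported core AREA) bound in the
        skeleton tuple, jointly continuous in (p,τ), and tied to the tangential speed by the similarity-frame CORE-AREA LAW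
        `w·Aa′ = (3/2 − w′)·Aa + 4`, `Aa > 0` (regular solution: `Aa(c) = 4/(w′(c) − 3/2)`, support CoreAreaNecessity 15404).
VARIANT A1 (mathematically leaner: ONE skeleton instead of a box family) is given in § A1 below with its own glue/closes.
-/

set_option linter.dupNamespace false
set_option linter.unusedVariables false

noncomputable section

namespace Summit.NavierStokesRegularity.NavierStokesRegularity.Cruxes.SelectionBoxRJ.RetypeKit

open Set Function Filter MeasureTheory Real
open Literature.Analysis.FluidPDE Literature.Analysis.FluidPDE.PineauVicol2026
open Summit.NavierStokesRegularity.NavierStokesRegularity.Theses.FilamentSkeletonRss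
open Summit.NavierStokesRegularity.NavierStokesRegularity.Theorems
open scoped InnerProductSpace Laplacian ContDiff Topology BigOperators

/-! ## Variant A2 — box kept, selection removed, core-matched regularisation -/

/-- crux (rank 2; replaces 21220 `SelectionBoxRJ`): the tilted, parameter-bounded, ball-exact skeleton BOX with transported
matched core areas — `SelectionBoxRJ` minus the sign law, plus (R-μ).  [difficulty: L/XL; the lane's BallBox trajectory] -/
def SkeletonBoxJ : Prop :=
(open Literature.Analysis.FluidPDE in ∃ (N:ℕ) (δ ρ K Λ a b cnd η Rw Rb cg θ₀ Γ₂:ℝ), 0 < N ∧ 0 < δ ∧ 0 < ρ ∧ 0 ≤ a ∧ 0 < cnd ∧ 0 < η ∧ 0 < Rw ∧ 0 < Rb ∧ 0 < cg ∧ 0 < θ₀ ∧ ∀ Γ:ℝ, Γ₂≤Γ → ∃ (γ:(Fin N→ℝ) → Fin N → ℝ) (α:(Fin N→ℝ) → ℝ) (X:(Fin N→ℝ) → Fin N → ℝ → EuclideanSpace ℝ (Fin 3)) (w:(Fin N→ℝ) → Fin N → ℝ → ℝ) (c:(Fin N→ℝ) → Fin N → ℝ) (m n:(Fin N→ℝ)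 → Fin N → EuclideanSpace ℝ (Fin 3)) (Aa:(Fin N→ℝ) → Fin N → ℝ → ℝ), ∀ (u:(Fin N→ℝ)→(Fin N → ℝ → EuclideanSpace ℝ (Fin 3)) → EuclideanSpace ℝ (Fin 3) → EuclideanSpace ℝ (Fin 3)) (v:(Fin N→ℝ) → EuclideanSpace ℝ (Fin 3) → EuclideanSpace ℝ (Fin 3)) (A:(Fin N→ℝ) → Fin N → (EuclideanSpace ℝ (Fin 3) →L[ℝ] EuclideanSpace ℝ (Fin 3))) (T:(Fin N→ℝ)→(Fin N → ℝ → EuclideanSpace ℝ (Fin 3)) → Fin N → ℝ → EuclideanSpace ℝ (Fin 3)), (∀ p Z y, u p Z y = ∑ k, (Γ*γ p k/(4*Real.pi))•∫ σ:ℝ, ((‖y-Z k σ‖^2+Real.exp (-(1+Real.eulerMascheroniConstant-Real.log 2))*Aa p k σ)^(3/2:ℝ))⁻¹•cross (deriv (Z k) σ) (y-Z k σ))→(∀ p y, v p y = u p (X p) y+(1/2:ℝ)•y-α p•cross (EuclideanSpace.single 2 1) y)→(∀ p j, A p j = fderiv ℝ (v p) (X p j (c p j)))→(∀ p Z j τ,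 T p Z j τ = (u p Z (Z j τ)+(1/2:ℝ)•Z j τ-α p•cross (EuclideanSpace.single 2 1) (Z j τ))-(⟪u p Z (Z j τ)+(1/2:ℝ)•Z j τ-α p•cross (EuclideanSpace.single 2 1) (Z j τ), deriv (Z j) τ⟫_ℝ/‖deriv (Z j) τ‖^2)•deriv (Z j) τ)→((∀ j, ContinuousOn (fun q:(Fin N→ℝ) × ℝ => (α q.1, γ q.1 j, X q.1 j q.2, w q.1 j q.2, Aa q.1 j q.2)) ({p:Fin N → ℝ | ∀ i, p i ∈ Icc 0 1} ×ˢ univ))∧(∀ p:Fin N → ℝ, (∀ i, p i ∈ Icc 0 1) → α p ≠ 0 ∧ (∀ j, γ p j ≠ 0)∧(∀ j, ContDiff ℝ 2 (X p j) ∧ Differentiable ℝ (w p j)∧(∀ τ, ‖deriv (X p j) τ‖ = 1)∧(∀ τ, ‖iteratedDeriv 2 (X p j) τ‖*√Γ≤K) ∧ Tendsto (fun τ => ‖X p j τ‖) (cocompact ℝ) atTop)∧(∀ j k, j ≠ k → ∀ τ σ, ρ*√Γ≤‖X p j τ-X p k σ‖)∧(∀ j τ σ, ρ*√Γ≤|τ-σ|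 → cg*ρ*√Γ≤‖X p j τ-X p j σ‖)∧(∀ j τ, cg*|τ-c p j|≤Rw*√Γ+‖X p j τ‖)∧(∀ j τ, w p j τ = ⟪v p (X p j τ), deriv (X p j) τ⟫_ℝ)∧(∀ j τ, ‖X p j τ‖≤Rb*√(Γ*Real.log Γ) → v p (X p j τ) = w p j τ•deriv (X p j) τ)∧(∀ j, ‖X p j (c p j)‖≤Rw*√Γ)∧(∀ j, |⟪deriv (X p j) (c p j), EuclideanSpace.single 2 1⟫_ℝ|≤1-θ₀)∧(θ₀≤|α p| ∧ |α p|≤θ₀⁻¹ ∧ ∀ j, θ₀≤|γ p j| ∧ |γ p j|≤θ₀⁻¹)∧(∀ j, w p j (c p j) = 0 ∧ (∀ τ, w p j τ = 0 → τ = c p j) ∧ 3/2+δ≤deriv (w p j) (c p j) ∧ deriv (w p j) (c p j)≤Λ)∧(∀ j, Differentiable ℝ (Aa p j) ∧ (∀ τ, 0 < Aa p j τ) ∧ ∀ τ, w p j τ*deriv (Aa p j) τ = (3/2-deriv (w p j) τ)*Aa p j τ+4)∧(∀ j, Orthonormal ℝ ![deriv (X p j) (c p j), m p j, n p j] ∧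 ⟪A p j (m p j), m p j⟫_ℝ+⟪A p j (n p j), n p j⟫_ℝ < 0 ∧ ⟪A p j (n p j), m p j⟫_ℝ * ⟪A p j (m p j), n p j⟫_ℝ < ⟪A p j (m p j), m p j⟫_ℝ * ⟪A p j (n p j), n p j⟫_ℝ)∧(∀ Y:Fin N → ℝ → EuclideanSpace ℝ (Fin 3), (∀ j, ContDiff ℝ 2 (Y j))→(∀ j τ, ⟪Y j τ, deriv (X p j) τ⟫_ℝ = 0) → (∀ j τ, Rb*√(Γ*Real.log Γ) < ‖X p j τ‖ → Y j τ = 0) → ∑ j, ⟪Y j (c p j), cross (EuclideanSpace.single 2 1) (X p j (c p j))⟫_ℝ = 0 → (∀ j τ, ‖Y j τ‖+‖deriv (Y j) τ‖+‖iteratedDeriv 2 (Y j) τ‖≤(1+|τ-c p j|)^b) → ∀ L:ℝ, (∀ j τ, ‖deriv (fun s:ℝ => T p (fun k σ => X p k σ+s•Y k σ) j τ) 0‖≤L*(1+|τ-c p j|)^a) → ∀ j τ, ‖Y j τ‖≤cnd*L*(1+|τ-c p j|)^b))))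

/-- crux (rank 3; replaces 21221 `TransverseReductionRJ`): UNFORCED transverse reduction — for every box skeleton as in
`SkeletonBoxJ` and every η > 0, for Γ ≥ Γ₁ an EXACT smooth Type-I rotated-Leray profile with bounded pressure sits η√Γ-close
(off the ρ√Γ/4-tubes, inside the ball Rw√Γ) to the core-matched skeleton velocity, for every p in the box.  This is
`CoreGluingGivenInvertibility` restricted to the box class (the Lyapunov–Schmidt step has NO finite-dimensional remainder in
the m = 0 torque directions: memo §3, Theorems `…TorqueFreePotential`, `…TorqueMultiplierODE`).  [difficulty: XL] -/
def TransverseReduction0 : Prop :=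
(open Literature.Analysis.FluidPDE in ∀ (N:ℕ) (δ ρ K Λ a b cnd η Rw Rb cg θ₀:ℝ), 0 < N → 0 < δ → 0 < ρ → 0 ≤ a → 0 < η → 0 < Rw → 0 < Rb → 0 < cg → 0 < θ₀ → ∃ Γ₁:ℝ, ∀ Γ:ℝ, Γ₁≤Γ → ∀ (γ:(Fin N→ℝ) → Fin N → ℝ) (α:(Fin N→ℝ) → ℝ) (X:(Fin N→ℝ) → Fin N → ℝ → EuclideanSpace ℝ (Fin 3)) (w:(Fin N→ℝ) → Fin N → ℝ → ℝ) (c:(Fin N→ℝ) → Fin N → ℝ) (m n:(Fin N→ℝ) → Fin N → EuclideanSpace ℝ (Fin 3)) (Aa:(Fin N→ℝ) → Fin N → ℝ → ℝ) (u:(Fin N→ℝ)→(Fin N → ℝ → EuclideanSpace ℝ (Fin 3)) → EuclideanSpace ℝ (Fin 3) → EuclideanSpace ℝ (Fin 3)) (v:(Fin N→ℝ) → EuclideanSpace ℝ (Fin 3) → EuclideanSpace ℝ (Fin 3)) (A:(Fin N→ℝ) → Fin N → (EuclideanSpace ℝ (Fin 3) →L[ℝ] EuclideanSpace ℝ (Fin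 3))) (T:(Fin N→ℝ)→(Fin N → ℝ → EuclideanSpace ℝ (Fin 3)) → Fin N → ℝ → EuclideanSpace ℝ (Fin 3)), (∀ p Z y, u p Z y = ∑ k, (Γ*γ p k/(4*Real.pi))•∫ σ:ℝ, ((‖y-Z k σ‖^2+Real.exp (-(1+Real.eulerMascheroniConstant-Real.log 2))*Aa p k σ)^(3/2:ℝ))⁻¹•cross (deriv (Z k) σ) (y-Z k σ))→(∀ p y, v p y = u p (X p) y+(1/2:ℝ)•y-α p•cross (EuclideanSpace.single 2 1) y)→(∀ p j, A p j = fderiv ℝ (v p) (X p j (c p j)))→(∀ p Z j τ, T p Z j τ = (u p Z (Z j τ)+(1/2:ℝ)•Z j τ-α p•cross (EuclideanSpace.single 2 1) (Z j τ))-(⟪u p Z (Z j τ)+(1/2:ℝ)•Z j τ-α p•cross (EuclideanSpace.single 2 1) (Z j τ), deriv (Z j) τ⟫_ℝ/‖deriv (Z j) τ‖^2)•deriv (Z j) τ)→((∀ j, ContinuousOn (fun q:(Fin N→ℝ) × ℝ => (α q.1, γ q.1 j, X q.1 j q.2, w q.1 j q.2, Aa q.1 j q.2)) ({p:Fin N →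 ℝ | ∀ i, p i ∈ Icc 0 1} ×ˢ univ))∧(∀ p:Fin N → ℝ, (∀ i, p i ∈ Icc 0 1) → α p ≠ 0 ∧ (∀ j, γ p j ≠ 0)∧(∀ j, ContDiff ℝ 2 (X p j) ∧ Differentiable ℝ (w p j)∧(∀ τ, ‖deriv (X p j) τ‖ = 1)∧(∀ τ, ‖iteratedDeriv 2 (X p j) τ‖*√Γ≤K) ∧ Tendsto (fun τ => ‖X p j τ‖) (cocompact ℝ) atTop)∧(∀ j k, j ≠ k → ∀ τ σ, ρ*√Γ≤‖X p j τ-X p k σ‖)∧(∀ j τ σ, ρ*√Γ≤|τ-σ| → cg*ρ*√Γ≤‖X p j τ-X p j σ‖)∧(∀ j τ, cg*|τ-c p j|≤Rw*√Γ+‖X p j τ‖)∧(∀ j τ, w p j τ = ⟪v p (X p j τ), deriv (X p j) τ⟫_ℝ)∧(∀ j τ, ‖X p j τ‖≤Rb*√(Γ*Real.log Γ) → v p (X p j τ) = w p j τ•deriv (X p j) τ)∧(∀ j, ‖X p j (c p j)‖≤Rw*√Γ)∧(∀ j, |⟪deriv (X p j) (c p j), EuclideanSpace.single 2 1⟫_ℝ|≤1-θ₀)∧(θ₀≤|α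 p| ∧ |α p|≤θ₀⁻¹ ∧ ∀ j, θ₀≤|γ p j| ∧ |γ p j|≤θ₀⁻¹)∧(∀ j, w p j (c p j) = 0 ∧ (∀ τ, w p j τ = 0 → τ = c p j) ∧ 3/2+δ≤deriv (w p j) (c p j) ∧ deriv (w p j) (c p j)≤Λ)∧(∀ j, Differentiable ℝ (Aa p j) ∧ (∀ τ, 0 < Aa p j τ) ∧ ∀ τ, w p j τ*deriv (Aa p j) τ = (3/2-deriv (w p j) τ)*Aa p j τ+4)∧(∀ j, Orthonormal ℝ ![deriv (X p j) (c p j), m p j, n p j] ∧ ⟪A p j (m p j), m p j⟫_ℝ+⟪A p j (n p j), n p j⟫_ℝ < 0 ∧ ⟪A p j (n p j), m p j⟫_ℝ * ⟪A p j (m p j), n p j⟫_ℝ < ⟪A p j (m p j), m p j⟫_ℝ * ⟪A p j (n p j), n p j⟫_ℝ)∧(∀ Y:Fin N → ℝ → EuclideanSpace ℝ (Fin 3), (∀ j, ContDiff ℝ 2 (Y j))→(∀ j τ, ⟪Y j τ, deriv (X p j) τ⟫_ℝ = 0) → (∀ j τ, Rb*√(Γ*Real.log Γ) < ‖X p j τ‖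 → Y j τ = 0) → ∑ j, ⟪Y j (c p j), cross (EuclideanSpace.single 2 1) (X p j (c p j))⟫_ℝ = 0 → (∀ j τ, ‖Y j τ‖+‖deriv (Y j) τ‖+‖iteratedDeriv 2 (Y j) τ‖≤(1+|τ-c p j|)^b) → ∀ L:ℝ, (∀ j τ, ‖deriv (fun s:ℝ => T p (fun k σ => X p k σ+s•Y k σ) j τ) 0‖≤L*(1+|τ-c p j|)^a) → ∀ j τ, ‖Y j τ‖≤cnd*L*(1+|τ-c p j|)^b))) → ∃ (C₀ M:ℝ) (U:(Fin N→ℝ) → EuclideanSpace ℝ (Fin 3) → EuclideanSpace ℝ (Fin 3)) (P:(Fin N→ℝ) → EuclideanSpace ℝ (Fin 3) → ℝ), (∀ p:Fin N → ℝ, (∀ i, p i ∈ Icc 0 1) → U p ≠ 0 ∧ ContDiff ℝ (⊤:ℕ∞) (U p) ∧ ContDiff ℝ (⊤:ℕ∞) (P p) ∧ VectorCalculus.IsDivFree (U p)∧(∀ y, α p•(cross (EuclideanSpace.single 2 1) (U p y)-fderiv ℝ (U p) y (cross (EuclideanSpace.single 2 1) y))+(1/2:ℝ)•U p y+(1/2:ℝ)•fderiv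 ℝ (U p) y y-(Laplacian.laplacian (U p)) y+fderiv ℝ (U p) y (U p y)+gradient (P p) y = 0)∧(∀ y, ‖U p y‖≤C₀/(1+‖y‖))∧(∀ y, |P p y|≤M)∧(∀ y, ‖y‖≤Rw*√Γ → (∀ j τ, ρ*√Γ/4≤‖y-X p j τ‖) → ‖U p y-u p (X p) y‖≤η*√Γ)))

/-- glue (provable now; replaces 21226 `BoxSelectionRJ`): `SkeletonBoxJ → TransverseReduction0 → RssProfileExists`. -/
def BoxSelection0 : Prop :=
  SkeletonBoxJ → TransverseReduction0 → RssProfileExists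

/-- The replacement selection glue, PROVED: box at `Γ = max Γ₁ Γ₂` ⇒ exact profile family ⇒ its member at the corner
`p = 0` is an exact smooth decaying rotated-Leray profile ⇒ `RssProfileExists` (`Theorems.stub_rssProfileExists_of_profile`,
p130189).  No Poincaré–Miranda, no sign law. -/
theorem boxSelection0_proof : BoxSelection0 := by
  unfold BoxSelection0
  intro hbox hred
  classical
  obtain ⟨N, δ, ρ, K, Λ, a, b, cnd, η, Rw, Rb, cg, θ₀, Γ₂, hN, hδ, hρ, ha, _hcnd, hη, hRw, hRb, hcg, hθ₀, hbox⟩ :=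
    hbox
  obtain ⟨Γ₁, hred⟩ := hred N δ ρ K Λ a b cnd η Rw Rb cg θ₀ hN hδ hρ ha hη hRw hRb hcg hθ₀
  obtain ⟨γ, α, X, w, c, m, n, Aa, hfam⟩ := hbox (max Γ₁ Γ₂) (le_max_right _ _)
  set Γ : ℝ := max Γ₁ Γ₂
  set u : (Fin N → ℝ) → (Fin N → ℝ → EuclideanSpace ℝ (Fin 3)) → EuclideanSpace ℝ (Fin 3) →
      EuclideanSpace ℝ (Fin 3) := fun p Z y => ∑ k : Fin N, (Γ * γ p k / (4 * π)) • ∫ σ : ℝ,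
        ((‖y - Z k σ‖ ^ 2 + Real.exp (-(1 + Real.eulerMascheroniConstant - Real.log 2)) * Aa p k σ) ^ (3 / 2 : ℝ))⁻¹ •
          cross (deriv (Z k) σ) (y - Z k σ)
  set v : (Fin N → ℝ) → EuclideanSpace ℝ (Fin 3) → EuclideanSpace ℝ (Fin 3) :=
    fun p y => u p (X p) y + (1 / 2 : ℝ) • y - α p • cross (EuclideanSpace.single (2 : Fin 3) (1 : ℝ)) y
  set A : (Fin N → ℝ) → Fin N → (EuclideanSpace ℝ (Fin 3) →L[ℝ] EuclideanSpace ℝ (Fin 3)) :=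
    fun p j => fderiv ℝ (v p) (X p j (c p j))
  set T : (Fin N → ℝ) → (Fin N → ℝ → EuclideanSpace ℝ (Fin 3)) → Fin N → ℝ →
      EuclideanSpace ℝ (Fin 3) :=
    fun p Z j τ => (u p Z (Z j τ) + (1 / 2 : ℝ) • Z j τ - α p • cross (EuclideanSpace.single (2 : Fin 3) (1 : ℝ)) (Z j τ)) -
      (inner ℝ (u p Z (Z j τ) + (1 / 2 : ℝ) • Z j τ - α p • cross (EuclideanSpace.single (2 : Fin 3) (1 : ℝ)) (Z j τ)) (deriv (Z j) τ) /
        ‖deriv (Z j) τ‖ ^ 2) • deriv (Z j) τ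
  obtain ⟨hcont, hskel⟩ := hfam u v A T (fun _ _ _ => rfl) (fun _ _ => rfl) (fun _ _ => rfl) (fun _ _ _ _ => rfl)
  obtain ⟨C₀, M, U, P, hfamU⟩ := hred Γ (le_max_left _ _) γ α X w c m n Aa u v A T
    (fun _ _ _ => rfl) (fun _ _ => rfl) (fun _ _ => rfl) (fun _ _ _ _ => rfl) ⟨hcont, hskel⟩
  -- the corner p = 0 of the box
  set p0 : Fin N → ℝ := fun _ => 0
  have hp0 : ∀ i, p0 i ∈ Icc (0:ℝ) 1 := fun _ => ⟨le_rfl, zero_le_one⟩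
  obtain ⟨hU0, hUs, hPs, hdiv, heq, hdec, hPM, -⟩ := hfamU p0 hp0
  have heq0 : ∀ y : EuclideanSpace ℝ (Fin 3), α p0 • (rotGen (U p0 y) - fderiv ℝ (U p0) y (rotGen y)) +
      (1 / 2 : ℝ) • U p0 y + (1 / 2 : ℝ) • fderiv ℝ (U p0) y y - (Δ (U p0)) y +
      fderiv ℝ (U p0) y (U p0 y) + gradient (P p0) y = 0 := by
    intro y
    simp only [splitGlue_rotGen_eq_cross_single_two]
    exact heq y
  exact stub_rssProfileExists_of_profile
    ⟨α p0, C₀, M, U p0, P p0, (hskel p0 hp0).1, hU0, hUs, hPs, hdiv, heq0, hdec, hPM⟩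

/-- The replacement DECIDING THEOREM (what `ledger route edit … --closes-file` would carry): the new open pair + the
PROVED truncation bridge give `¬ NavierStokesRegularity`; body = route rev-12 `closes` with its first line replaced. -/
theorem closes0 (hBox : SkeletonBoxJ) (hTR : TransverseReduction0) (hT : RdssProfileTruncation) :
    ¬ _root_.NavierStokesRegularity := by
  obtain ⟨α, C₀, U, Rot, u, -, -, hU2, hU0, hu1, hrss, hmild, hmeas, hC⟩ := boxSelection0_proof hBox hTR
  have hrdss : Literature.Analysis.FluidPDE.IsRotatedDSS 2 (Rot (-(α * (2 * Real.log 2)))) u :=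
    hrss 2 two_pos
  have hnz : ¬ (∀ t < 0, u t =ᵐ[volume] 0) := by
    intro h
    have h1 := h (-1) (by norm_num)
    rw [hu1] at h1
    exact hU0 ((Continuous.ae_eq_iff_eq volume hU2.continuous continuous_const).1 h1)
  obtain ⟨ν, hν, T, hT, v, q, ⟨hcl, hmax⟩, hLH, hdec⟩ :=
    hT ⟨2, _, _, one_lt_two, hmild, hmeas, hrdss, ⟨C₀, hC⟩, hnz⟩
  intro hA
  have h0 : (0 : ℝ) ∈ Set.Ico 0 T := ⟨le_rfl, hT⟩
  obtain ⟨u', p', hu', hp', hns, hbe⟩ :=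
    hA ν hν (v 0) (hcl.contDiff_velocity h0) (hcl.divFree 0 h0) hdec
  have heq : ∀ t ∈ Set.Ico 0 T, u' t = v t :=
    _root_.Summit.NavierStokesRegularity.NavierStokesRegularity.Theorems.blowup_clay_uniqueness
      ν hν (v 0) hdec u' v p' q T hT hu' hp' hns hbe hcl hLH rfl
  have hcl' : Literature.Analysis.FluidPDE.IsClassicalNSSolutionOn (Set.Ici 0) ν 0 u' p' :=
    ⟨hu', hp', fun t ht x => hns.momentum t ht x, fun t ht => hns.divFree t ht⟩
  refine hmax ⟨T + 1, by linarith, u', p', ?_, heq⟩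
  exact hcl'.mono (fun t ht => ht.1) (uniqueDiffOn_Ico 0 (T + 1))

/-- RdssProfileTruncation is PROVED in tree (item 11289), so after the retype the route's open load-bearing binders are
exactly the pair (SkeletonBoxJ, TransverseReduction0). -/
example (hBox : SkeletonBoxJ) (hTR : TransverseReduction0) (hT : RdssProfileTruncation) : ¬ _root_.NavierStokesRegularity :=
  closes0 hBox hTR hT

/-! ## Variant A1 — ONE skeleton (no parameter box), selection removed, core-matched regularisation

Without a selection step the `p`-box is not needed: the same clauses for a single skeleton (γ, α, X, w, c, m, n, Aa), and
the reduction delivers ONE exact profile.  Leaner cruxes; the lane's box-construction rungs still serve (a box contains a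
skeleton).  The 21221 rate-locking helpers (KelvinGate*, statements about `p`-families) then support nothing in the cone. -/

/-- crux (rank 2, Variant A1): a single tilted, parameter-bounded, ball-exact skeleton with transported matched core areas,
for every large Γ. -/
def SkeletonJ1 : Prop :=
(open Literature.Analysis.FluidPDE in ∃ (N:ℕ) (δ ρ K Λ a b cnd η Rw Rb cg θ₀ Γ₂:ℝ), 0 < N ∧ 0 < δ ∧ 0 < ρ ∧ 0 ≤ a ∧ 0 < cnd ∧ 0 < η ∧ 0 < Rw ∧ 0 < Rb ∧ 0 < cg ∧ 0 < θ₀ ∧ ∀ Γ:ℝ, Γ₂≤Γ → ∃ (γ:Fin N → ℝ) (α:ℝ) (X:Fin N → ℝ → EuclideanSpace ℝ (Fin 3)) (w:Fin N → ℝ → ℝ) (c:Fin N → ℝ) (m n:Fin N → EuclideanSpace ℝ (Fin 3)) (Aa:Fin N → ℝ → ℝ), ∀ (u:(Fin N → ℝ → EuclideanSpace ℝ (Fin 3)) → EuclideanSpace ℝ (Fin 3) → EuclideanSpace ℝ (Fin 3)) (v:EuclideanSpace ℝ (Fin 3) → EuclideanSpace ℝ (Fin 3)) (A:Fin N → (EuclideanSpace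 ℝ (Fin 3) →L[ℝ] EuclideanSpace ℝ (Fin 3))) (T:(Fin N → ℝ → EuclideanSpace ℝ (Fin 3)) → Fin N → ℝ → EuclideanSpace ℝ (Fin 3)), (∀ Z y, u Z y = ∑ k, (Γ*γ k/(4*Real.pi))•∫ σ:ℝ, ((‖y-Z k σ‖^2+Real.exp (-(1+Real.eulerMascheroniConstant-Real.log 2))*Aa k σ)^(3/2:ℝ))⁻¹•cross (deriv (Z k) σ) (y-Z k σ))→(∀ y, v y = u X y+(1/2:ℝ)•y-α•cross (EuclideanSpace.single 2 1) y)→(∀ j, A j = fderiv ℝ v (X j (c j)))→(∀ Z j τ, T Z j τ = (u Z (Z j τ)+(1/2:ℝ)•Z j τ-α•cross (EuclideanSpace.single 2 1) (Z j τ))-(⟪u Z (Z j τ)+(1/2:ℝ)•Z j τ-α•cross (EuclideanSpace.single 2 1) (Z j τ), deriv (Z j) τ⟫_ℝ/‖deriv (Z j) τ‖^2)•deriv (Z j) τ)→((α ≠ 0 ∧ (∀ j, γ j ≠ 0)∧(∀ j, ContDiff ℝ 2 (X j) ∧ Differentiable ℝ (w j)∧(∀ τ, ‖deriv (X j) τ‖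 = 1)∧(∀ τ, ‖iteratedDeriv 2 (X j) τ‖*√Γ≤K) ∧ Tendsto (fun τ => ‖X j τ‖) (cocompact ℝ) atTop)∧(∀ j k, j ≠ k → ∀ τ σ, ρ*√Γ≤‖X j τ-X k σ‖)∧(∀ j τ σ, ρ*√Γ≤|τ-σ| → cg*ρ*√Γ≤‖X j τ-X j σ‖)∧(∀ j τ, cg*|τ-c j|≤Rw*√Γ+‖X j τ‖)∧(∀ j τ, w j τ = ⟪v (X j τ), deriv (X j) τ⟫_ℝ)∧(∀ j τ, ‖X j τ‖≤Rb*√(Γ*Real.log Γ) → v (X j τ) = w j τ•deriv (X j) τ)∧(∀ j, ‖X j (c j)‖≤Rw*√Γ)∧(∀ j, |⟪deriv (X j) (c j), EuclideanSpace.single 2 1⟫_ℝ|≤1-θ₀)∧(θ₀≤|α| ∧ |α|≤θ₀⁻¹ ∧ ∀ j, θ₀≤|γ j| ∧ |γ j|≤θ₀⁻¹)∧(∀ j, w j (c j) = 0 ∧ (∀ τ, w j τ = 0 → τ = c j) ∧ 3/2+δ≤deriv (w j) (c j) ∧ deriv (w j) (c j)≤Λ)∧(∀ j, Differentiable ℝ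 (Aa j) ∧ (∀ τ, 0 < Aa j τ) ∧ ∀ τ, w j τ*deriv (Aa j) τ = (3/2-deriv (w j) τ)*Aa j τ+4)∧(∀ j, Orthonormal ℝ ![deriv (X j) (c j), m j, n j] ∧ ⟪A j (m j), m j⟫_ℝ+⟪A j (n j), n j⟫_ℝ < 0 ∧ ⟪A j (n j), m j⟫_ℝ * ⟪A j (m j), n j⟫_ℝ < ⟪A j (m j), m j⟫_ℝ * ⟪A j (n j), n j⟫_ℝ)∧(∀ Y:Fin N → ℝ → EuclideanSpace ℝ (Fin 3), (∀ j, ContDiff ℝ 2 (Y j))→(∀ j τ, ⟪Y j τ, deriv (X j) τ⟫_ℝ = 0) → (∀ j τ, Rb*√(Γ*Real.log Γ) < ‖X j τ‖ → Y j τ = 0) → ∑ j, ⟪Y j (c j), cross (EuclideanSpace.single 2 1) (X j (c j))⟫_ℝ = 0 → (∀ j τ, ‖Y j τ‖+‖deriv (Y j) τ‖+‖iteratedDeriv 2 (Y j) τ‖≤(1+|τ-c j|)^b) → ∀ L:ℝ, (∀ j τ, ‖deriv (fun s:ℝ => T (fun k σ => X k σ+s•Y k σ) j τ) 0‖≤L*(1+|τ-c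 j|)^a) → ∀ j τ, ‖Y j τ‖≤cnd*L*(1+|τ-c j|)^b))))

/-- crux (rank 3, Variant A1): unforced transverse reduction at a single skeleton. -/
def TransverseReduction1 : Prop :=
(open Literature.Analysis.FluidPDE in ∀ (N:ℕ) (δ ρ K Λ a b cnd η Rw Rb cg θ₀:ℝ), 0 < N → 0 < δ → 0 < ρ → 0 ≤ a → 0 < η → 0 < Rw → 0 < Rb → 0 < cg → 0 < θ₀ → ∃ Γ₁:ℝ, ∀ Γ:ℝ, Γ₁≤Γ → ∀ (γ:Fin N → ℝ) (α:ℝ) (X:Fin N → ℝ → EuclideanSpace ℝ (Fin 3)) (w:Fin N → ℝ → ℝ) (c:Fin N → ℝ) (m n:Fin N → EuclideanSpace ℝ (Fin 3)) (Aa:Fin N → ℝ → ℝ) (u:(Fin N → ℝ → EuclideanSpace ℝ (Fin 3)) → EuclideanSpace ℝ (Fin 3) → EuclideanSpace ℝ (Fin 3)) (v:EuclideanSpace ℝ (Fin 3) → EuclideanSpace ℝ (Fin 3)) (A:Fin N → (EuclideanSpace ℝ (Fin 3) →L[ℝ] EuclideanSpace ℝ (Fin 3))) (T:(Fin N → ℝ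 → EuclideanSpace ℝ (Fin 3)) → Fin N → ℝ → EuclideanSpace ℝ (Fin 3)), (∀ Z y, u Z y = ∑ k, (Γ*γ k/(4*Real.pi))•∫ σ:ℝ, ((‖y-Z k σ‖^2+Real.exp (-(1+Real.eulerMascheroniConstant-Real.log 2))*Aa k σ)^(3/2:ℝ))⁻¹•cross (deriv (Z k) σ) (y-Z k σ))→(∀ y, v y = u X y+(1/2:ℝ)•y-α•cross (EuclideanSpace.single 2 1) y)→(∀ j, A j = fderiv ℝ v (X j (c j)))→(∀ Z j τ, T Z j τ = (u Z (Z j τ)+(1/2:ℝ)•Z j τ-α•cross (EuclideanSpace.single 2 1) (Z j τ))-(⟪u Z (Z j τ)+(1/2:ℝ)•Z j τ-α•cross (EuclideanSpace.single 2 1) (Z j τ), deriv (Z j) τ⟫_ℝ/‖deriv (Z j) τ‖^2)•deriv (Z j) τ)→((α ≠ 0 ∧ (∀ j, γ j ≠ 0)∧(∀ j, ContDiff ℝ 2 (X j) ∧ Differentiable ℝ (w j)∧(∀ τ, ‖deriv (X j) τ‖ = 1)∧(∀ τ, ‖iteratedDeriv 2 (X j) τ‖*√Γ≤K) ∧ Tendsto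 (fun τ => ‖X j τ‖) (cocompact ℝ) atTop)∧(∀ j k, j ≠ k → ∀ τ σ, ρ*√Γ≤‖X j τ-X k σ‖)∧(∀ j τ σ, ρ*√Γ≤|τ-σ| → cg*ρ*√Γ≤‖X j τ-X j σ‖)∧(∀ j τ, cg*|τ-c j|≤Rw*√Γ+‖X j τ‖)∧(∀ j τ, w j τ = ⟪v (X j τ), deriv (X j) τ⟫_ℝ)∧(∀ j τ, ‖X j τ‖≤Rb*√(Γ*Real.log Γ) → v (X j τ) = w j τ•deriv (X j) τ)∧(∀ j, ‖X j (c j)‖≤Rw*√Γ)∧(∀ j, |⟪deriv (X j) (c j), EuclideanSpace.single 2 1⟫_ℝ|≤1-θ₀)∧(θ₀≤|α| ∧ |α|≤θ₀⁻¹ ∧ ∀ j, θ₀≤|γ j| ∧ |γ j|≤θ₀⁻¹)∧(∀ j, w j (c j) = 0 ∧ (∀ τ, w j τ = 0 → τ = c j) ∧ 3/2+δ≤deriv (w j) (c j) ∧ deriv (w j) (c j)≤Λ)∧(∀ j, Differentiable ℝ (Aa j) ∧ (∀ τ, 0 < Aa j τ) ∧ ∀ τ, w j τ*deriv (Aa j)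 τ = (3/2-deriv (w j) τ)*Aa j τ+4)∧(∀ j, Orthonormal ℝ ![deriv (X j) (c j), m j, n j] ∧ ⟪A j (m j), m j⟫_ℝ+⟪A j (n j), n j⟫_ℝ < 0 ∧ ⟪A j (n j), m j⟫_ℝ * ⟪A j (m j), n j⟫_ℝ < ⟪A j (m j), m j⟫_ℝ * ⟪A j (n j), n j⟫_ℝ)∧(∀ Y:Fin N → ℝ → EuclideanSpace ℝ (Fin 3), (∀ j, ContDiff ℝ 2 (Y j))→(∀ j τ, ⟪Y j τ, deriv (X j) τ⟫_ℝ = 0) → (∀ j τ, Rb*√(Γ*Real.log Γ) < ‖X j τ‖ → Y j τ = 0) → ∑ j, ⟪Y j (c j), cross (EuclideanSpace.single 2 1) (X j (c j))⟫_ℝ = 0 → (∀ j τ, ‖Y j τ‖+‖deriv (Y j) τ‖+‖iteratedDeriv 2 (Y j) τ‖≤(1+|τ-c j|)^b) → ∀ L:ℝ, (∀ j τ, ‖deriv (fun s:ℝ => T (fun k σ => X k σ+s•Y k σ) j τ) 0‖≤L*(1+|τ-c j|)^a) → ∀ j τ, ‖Y j τ‖≤cnd*L*(1+|τ-c j|)^b)))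 → ∃ (C₀ M:ℝ) (U:EuclideanSpace ℝ (Fin 3) → EuclideanSpace ℝ (Fin 3)) (P:EuclideanSpace ℝ (Fin 3) → ℝ), (U ≠ 0 ∧ ContDiff ℝ (⊤:ℕ∞) U ∧ ContDiff ℝ (⊤:ℕ∞) P ∧ VectorCalculus.IsDivFree U∧(∀ y, α•(cross (EuclideanSpace.single 2 1) (U y)-fderiv ℝ U y (cross (EuclideanSpace.single 2 1) y))+(1/2:ℝ)•U y+(1/2:ℝ)•fderiv ℝ U y y-(Laplacian.laplacian U) y+fderiv ℝ U y (U y)+gradient P y = 0)∧(∀ y, ‖U y‖≤C₀/(1+‖y‖))∧(∀ y, |P y|≤M)∧(∀ y, ‖y‖≤Rw*√Γ → (∀ j τ, ρ*√Γ/4≤‖y-X j τ‖) → ‖U y-u X y‖≤η*√Γ)))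

/-- glue (provable now, Variant A1). -/
def Selection1 : Prop :=
  SkeletonJ1 → TransverseReduction1 → RssProfileExists

theorem selection1_proof : Selection1 := by
  unfold Selection1
  intro hbox hred
  classical
  obtain ⟨N, δ, ρ, K, Λ, a, b, cnd, η, Rw, Rb, cg, θ₀, Γ₂, hN, hδ, hρ, ha, _hcnd, hη, hRw, hRb, hcg, hθ₀, hbox⟩ :=
    hbox
  obtain ⟨Γ₁, hred⟩ := hred N δ ρ K Λ a b cnd η Rw Rb cg θ₀ hN hδ hρ ha hη hRw hRb hcg hθ₀
  obtain ⟨γ, α, X, w, c, m, n, Aa, hfam⟩ := hbox (max Γ₁ Γ₂) (le_max_right _ _)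
  set Γ : ℝ := max Γ₁ Γ₂
  set u : (Fin N → ℝ → EuclideanSpace ℝ (Fin 3)) → EuclideanSpace ℝ (Fin 3) → EuclideanSpace ℝ (Fin 3) :=
    fun Z y => ∑ k : Fin N, (Γ * γ k / (4 * π)) • ∫ σ : ℝ,
        ((‖y - Z k σ‖ ^ 2 + Real.exp (-(1 + Real.eulerMascheroniConstant - Real.log 2)) * Aa k σ) ^ (3 / 2 : ℝ))⁻¹ •
          cross (deriv (Z k) σ) (y - Z k σ)
  set v : EuclideanSpace ℝ (Fin 3) → EuclideanSpace ℝ (Fin 3) :=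
    fun y => u X y + (1 / 2 : ℝ) • y - α • cross (EuclideanSpace.single (2 : Fin 3) (1 : ℝ)) y
  set A : Fin N → (EuclideanSpace ℝ (Fin 3) →L[ℝ] EuclideanSpace ℝ (Fin 3)) := fun j => fderiv ℝ v (X j (c j))
  set T : (Fin N → ℝ → EuclideanSpace ℝ (Fin 3)) → Fin N → ℝ → EuclideanSpace ℝ (Fin 3) :=
    fun Z j τ => (u Z (Z j τ) + (1 / 2 : ℝ) • Z j τ - α • cross (EuclideanSpace.single (2 : Fin 3) (1 : ℝ)) (Z j τ)) -
      (inner ℝ (u Z (Z j τ) + (1 / 2 : ℝ) • Z j τ - α • cross (EuclideanSpace.single (2 : Fin 3) (1 : ℝ)) (Z j τ)) (deriv (Z j) τ) /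
        ‖deriv (Z j) τ‖ ^ 2) • deriv (Z j) τ
  have hskel := hfam u v A T (fun _ _ => rfl) (fun _ => rfl) (fun _ => rfl) (fun _ _ _ => rfl)
  obtain ⟨C₀, M, U, P, hU0, hUs, hPs, hdiv, heq, hdec, hPM, -⟩ := hred Γ (le_max_left _ _) γ α X w c m n Aa u v A T
    (fun _ _ => rfl) (fun _ => rfl) (fun _ => rfl) (fun _ _ _ => rfl) hskel
  have heq0 : ∀ y : EuclideanSpace ℝ (Fin 3), α • (rotGen (U y) - fderiv ℝ U y (rotGen y)) +
      (1 / 2 : ℝ) • U y + (1 / 2 : ℝ) • fderiv ℝ U y y - (Δ U) y + fderiv ℝ U y (U y) + gradient P y = 0 := by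
    intro y
    simp only [splitGlue_rotGen_eq_cross_single_two]
    exact heq y
  exact stub_rssProfileExists_of_profile ⟨α, C₀, M, U, P, hskel.1, hU0, hUs, hPs, hdiv, heq0, hdec, hPM⟩

theorem closes1 (hSk : SkeletonJ1) (hTR : TransverseReduction1) (hT : RdssProfileTruncation) :
    ¬ _root_.NavierStokesRegularity := by
  obtain ⟨α, C₀, U, Rot, u, -, -, hU2, hU0, hu1, hrss, hmild, hmeas, hC⟩ := selection1_proof hSk hTR
  have hrdss : Literature.Analysis.FluidPDE.IsRotatedDSS 2 (Rot (-(α * (2 * Real.log 2)))) u := hrss 2 two_pos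
  have hnz : ¬ (∀ t < 0, u t =ᵐ[volume] 0) := by
    intro h
    have h1 := h (-1) (by norm_num)
    rw [hu1] at h1
    exact hU0 ((Continuous.ae_eq_iff_eq volume hU2.continuous continuous_const).1 h1)
  obtain ⟨ν, hν, T, hT, v, q, ⟨hcl, hmax⟩, hLH, hdec⟩ := hT ⟨2, _, _, one_lt_two, hmild, hmeas, hrdss, ⟨C₀, hC⟩, hnz⟩
  intro hA
  have h0 : (0 : ℝ) ∈ Set.Ico 0 T := ⟨le_rfl, hT⟩
  obtain ⟨u', p', hu', hp', hns, hbe⟩ := hA ν hν (v 0) (hcl.contDiff_velocity h0) (hcl.divFree 0 h0) hdec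
  have heq : ∀ t ∈ Set.Ico 0 T, u' t = v t :=
    _root_.Summit.NavierStokesRegularity.NavierStokesRegularity.Theorems.blowup_clay_uniqueness
      ν hν (v 0) hdec u' v p' q T hT hu' hp' hns hbe hcl hLH rfl
  have hcl' : Literature.Analysis.FluidPDE.IsClassicalNSSolutionOn (Set.Ici 0) ν 0 u' p' :=
    ⟨hu', hp', fun t ht x => hns.momentum t ht x, fun t ht => hns.divFree t ht⟩
  refine hmax ⟨T + 1, by linarith, u', p', ?_, heq⟩
  exact hcl'.mono (fun t ht => ht.1) (uniqueDiffOn_Ico 0 (T + 1))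

/-! ## Sanity: the new items are implied by the old J-twins' shapes only through the deleted parts — recorded, not used.
`SelectionBoxRJ → SkeletonBoxJ` does NOT hold verbatim (different kernel (R-μ), extra datum `Aa`); the retype is a
re-statement, and the refuted/misstated J-decls stay in the route file as settled negative edges (never re-worded). -/

/-! ## Variant A2∃ — answer to idea-crit-7 g2 PRICE (a) (09:16:48Z): box kept, rate α_p frozen to the skeleton datum, but the
reduction concludes an exact profile at SOME p of the box (the e₃-rotation cokernel is met by PARAMETER SELECTION — rate locking —
not by luck).  Glue unchanged in spirit: the selected p feeds `RssProfileExists`. -/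

/-- crux (rank 3, Variant A2∃): unforced transverse reduction on the box, concluding `∃ p ∈ box, exact profile at p`. -/
def TransverseReduction0E : Prop :=
(open Literature.Analysis.FluidPDE in ∀ (N:ℕ) (δ ρ K Λ a b cnd η Rw Rb cg θ₀:ℝ), 0 < N → 0 < δ → 0 < ρ → 0 ≤ a → 0 < η → 0 < Rw → 0 < Rb → 0 < cg → 0 < θ₀ → ∃ Γ₁:ℝ, ∀ Γ:ℝ, Γ₁≤Γ → ∀ (γ:(Fin N→ℝ) → Fin N → ℝ) (α:(Fin N→ℝ) → ℝ) (X:(Fin N→ℝ) → Fin N → ℝ → EuclideanSpace ℝ (Fin 3)) (w:(Fin N→ℝ) → Fin N → ℝ → ℝ) (c:(Fin N→ℝ) → Fin N → ℝ) (m n:(Fin N→ℝ) → Fin N → EuclideanSpace ℝ (Fin 3)) (Aa:(Fin N→ℝ) → Fin N → ℝ → ℝ) (u:(Fin N→ℝ)→(Fin N → ℝ → EuclideanSpace ℝ (Fin 3)) → EuclideanSpace ℝ (Fin 3) → EuclideanSpace ℝ (Fin 3)) (v:(Fin N→ℝ) → EuclideanSpace ℝ (Fin 3) → EuclideanSpace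 ℝ (Fin 3)) (A:(Fin N→ℝ) → Fin N → (EuclideanSpace ℝ (Fin 3) →L[ℝ] EuclideanSpace ℝ (Fin 3))) (T:(Fin N→ℝ)→(Fin N → ℝ → EuclideanSpace ℝ (Fin 3)) → Fin N → ℝ → EuclideanSpace ℝ (Fin 3)), (∀ p Z y, u p Z y = ∑ k, (Γ*γ p k/(4*Real.pi))•∫ σ:ℝ, ((‖y-Z k σ‖^2+Real.exp (-(1+Real.eulerMascheroniConstant-Real.log 2))*Aa p k σ)^(3/2:ℝ))⁻¹•cross (deriv (Z k) σ) (y-Z k σ))→(∀ p y, v p y = u p (X p) y+(1/2:ℝ)•y-α p•cross (EuclideanSpace.single 2 1) y)→(∀ p j, A p j = fderiv ℝ (v p) (X p j (c p j)))→(∀ p Z j τ, T p Z j τ = (u p Z (Z j τ)+(1/2:ℝ)•Z j τ-α p•cross (EuclideanSpace.single 2 1) (Z j τ))-(⟪u p Z (Z j τ)+(1/2:ℝ)•Z j τ-α p•cross (EuclideanSpace.single 2 1) (Z j τ), deriv (Z j) τ⟫_ℝ/‖deriv (Z j) τ‖^2)•deriv (Z j) τ)→((∀ j, ContinuousOn (fun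 q:(Fin N→ℝ) × ℝ => (α q.1, γ q.1 j, X q.1 j q.2, w q.1 j q.2, Aa q.1 j q.2)) ({p:Fin N → ℝ | ∀ i, p i ∈ Icc 0 1} ×ˢ univ))∧(∀ p:Fin N → ℝ, (∀ i, p i ∈ Icc 0 1) → α p ≠ 0 ∧ (∀ j, γ p j ≠ 0)∧(∀ j, ContDiff ℝ 2 (X p j) ∧ Differentiable ℝ (w p j)∧(∀ τ, ‖deriv (X p j) τ‖ = 1)∧(∀ τ, ‖iteratedDeriv 2 (X p j) τ‖*√Γ≤K) ∧ Tendsto (fun τ => ‖X p j τ‖) (cocompact ℝ) atTop)∧(∀ j k, j ≠ k → ∀ τ σ, ρ*√Γ≤‖X p j τ-X p k σ‖)∧(∀ j τ σ, ρ*√Γ≤|τ-σ| → cg*ρ*√Γ≤‖X p j τ-X p j σ‖)∧(∀ j τ, cg*|τ-c p j|≤Rw*√Γ+‖X p j τ‖)∧(∀ j τ, w p j τ = ⟪v p (X p j τ), deriv (X p j) τ⟫_ℝ)∧(∀ j τ, ‖X p j τ‖≤Rb*√(Γ*Real.log Γ) → v p (X p j τ) = w p j τ•deriv (X p j) τ)∧(∀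 j, ‖X p j (c p j)‖≤Rw*√Γ)∧(∀ j, |⟪deriv (X p j) (c p j), EuclideanSpace.single 2 1⟫_ℝ|≤1-θ₀)∧(θ₀≤|α p| ∧ |α p|≤θ₀⁻¹ ∧ ∀ j, θ₀≤|γ p j| ∧ |γ p j|≤θ₀⁻¹)∧(∀ j, w p j (c p j) = 0 ∧ (∀ τ, w p j τ = 0 → τ = c p j) ∧ 3/2+δ≤deriv (w p j) (c p j) ∧ deriv (w p j) (c p j)≤Λ)∧(∀ j, Differentiable ℝ (Aa p j) ∧ (∀ τ, 0 < Aa p j τ) ∧ ∀ τ, w p j τ*deriv (Aa p j) τ = (3/2-deriv (w p j) τ)*Aa p j τ+4)∧(∀ j, Orthonormal ℝ ![deriv (X p j) (c p j), m p j, n p j] ∧ ⟪A p j (m p j), m p j⟫_ℝ+⟪A p j (n p j), n p j⟫_ℝ < 0 ∧ ⟪A p j (n p j), m p j⟫_ℝ * ⟪A p j (m p j), n p j⟫_ℝ < ⟪A p j (m p j), m p j⟫_ℝ * ⟪A p j (n p j), n p j⟫_ℝ)∧(∀ Y:Fin N → ℝ → EuclideanSpace ℝ (Fin 3), (∀ j,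 ContDiff ℝ 2 (Y j))→(∀ j τ, ⟪Y j τ, deriv (X p j) τ⟫_ℝ = 0) → (∀ j τ, Rb*√(Γ*Real.log Γ) < ‖X p j τ‖ → Y j τ = 0) → ∑ j, ⟪Y j (c p j), cross (EuclideanSpace.single 2 1) (X p j (c p j))⟫_ℝ = 0 → (∀ j τ, ‖Y j τ‖+‖deriv (Y j) τ‖+‖iteratedDeriv 2 (Y j) τ‖≤(1+|τ-c p j|)^b) → ∀ L:ℝ, (∀ j τ, ‖deriv (fun s:ℝ => T p (fun k σ => X p k σ+s•Y k σ) j τ) 0‖≤L*(1+|τ-c p j|)^a) → ∀ j τ, ‖Y j τ‖≤cnd*L*(1+|τ-c p j|)^b))) → ∃ p:Fin N → ℝ, (∀ i, p i ∈ Icc 0 1) ∧ ∃ (C₀ M:ℝ) (U:EuclideanSpace ℝ (Fin 3) → EuclideanSpace ℝ (Fin 3)) (P:EuclideanSpace ℝ (Fin 3) → ℝ), (U ≠ 0 ∧ ContDiff ℝ (⊤:ℕ∞) U ∧ ContDiff ℝ (⊤:ℕ∞) P ∧ VectorCalculus.IsDivFree U∧(∀ y, α p•(cross (EuclideanSpace.single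 2 1) (U y)-fderiv ℝ U y (cross (EuclideanSpace.single 2 1) y))+(1/2:ℝ)•U y+(1/2:ℝ)•fderiv ℝ U y y-(Laplacian.laplacian U) y+fderiv ℝ U y (U y)+gradient P y = 0)∧(∀ y, ‖U y‖≤C₀/(1+‖y‖))∧(∀ y, |P y|≤M)∧(∀ y, ‖y‖≤Rw*√Γ → (∀ j τ, ρ*√Γ/4≤‖y-X p j τ‖) → ‖U y-u p (X p) y‖≤η*√Γ)))

/-- glue (provable now, Variant A2∃). -/
def BoxSelection0E : Prop :=
  SkeletonBoxJ → TransverseReduction0E → RssProfileExists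

theorem boxSelection0E_proof : BoxSelection0E := by
  unfold BoxSelection0E
  intro hbox hred
  classical
  obtain ⟨N, δ, ρ, K, Λ, a, b, cnd, η, Rw, Rb, cg, θ₀, Γ₂, hN, hδ, hρ, ha, _hcnd, hη, hRw, hRb, hcg, hθ₀, hbox⟩ :=
    hbox
  obtain ⟨Γ₁, hred⟩ := hred N δ ρ K Λ a b cnd η Rw Rb cg θ₀ hN hδ hρ ha hη hRw hRb hcg hθ₀
  obtain ⟨γ, α, X, w, c, m, n, Aa, hfam⟩ := hbox (max Γ₁ Γ₂) (le_max_right _ _)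
  set Γ : ℝ := max Γ₁ Γ₂
  set u : (Fin N → ℝ) → (Fin N → ℝ → EuclideanSpace ℝ (Fin 3)) → EuclideanSpace ℝ (Fin 3) →
      EuclideanSpace ℝ (Fin 3) := fun p Z y => ∑ k : Fin N, (Γ * γ p k / (4 * π)) • ∫ σ : ℝ,
        ((‖y - Z k σ‖ ^ 2 + Real.exp (-(1 + Real.eulerMascheroniConstant - Real.log 2)) * Aa p k σ) ^ (3 / 2 : ℝ))⁻¹ •
          cross (deriv (Z k) σ) (y - Z k σ)
  set v : (Fin N → ℝ) → EuclideanSpace ℝ (Fin 3) → EuclideanSpace ℝ (Fin 3) :=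
    fun p y => u p (X p) y + (1 / 2 : ℝ) • y - α p • cross (EuclideanSpace.single (2 : Fin 3) (1 : ℝ)) y
  set A : (Fin N → ℝ) → Fin N → (EuclideanSpace ℝ (Fin 3) →L[ℝ] EuclideanSpace ℝ (Fin 3)) :=
    fun p j => fderiv ℝ (v p) (X p j (c p j))
  set T : (Fin N → ℝ) → (Fin N → ℝ → EuclideanSpace ℝ (Fin 3)) → Fin N → ℝ →
      EuclideanSpace ℝ (Fin 3) :=
    fun p Z j τ => (u p Z (Z j τ) + (1 / 2 : ℝ) • Z j τ - α p • cross (EuclideanSpace.single (2 : Fin 3) (1 : ℝ)) (Z j τ)) -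
      (inner ℝ (u p Z (Z j τ) + (1 / 2 : ℝ) • Z j τ - α p • cross (EuclideanSpace.single (2 : Fin 3) (1 : ℝ)) (Z j τ)) (deriv (Z j) τ) /
        ‖deriv (Z j) τ‖ ^ 2) • deriv (Z j) τ
  obtain ⟨hcont, hskel⟩ := hfam u v A T (fun _ _ _ => rfl) (fun _ _ => rfl) (fun _ _ => rfl) (fun _ _ _ _ => rfl)
  obtain ⟨p0, hp0, C₀, M, U, P, hU0, hUs, hPs, hdiv, heq, hdec, hPM, -⟩ := hred Γ (le_max_left _ _) γ α X w c m n Aa u v A T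
    (fun _ _ _ => rfl) (fun _ _ => rfl) (fun _ _ => rfl) (fun _ _ _ _ => rfl) ⟨hcont, hskel⟩
  have heq0 : ∀ y : EuclideanSpace ℝ (Fin 3), α p0 • (rotGen (U y) - fderiv ℝ U y (rotGen y)) +
      (1 / 2 : ℝ) • U y + (1 / 2 : ℝ) • fderiv ℝ U y y - (Δ U) y + fderiv ℝ U y (U y) + gradient P y = 0 := by
    intro y
    simp only [splitGlue_rotGen_eq_cross_single_two]
    exact heq y
  exact stub_rssProfileExists_of_profile ⟨α p0, C₀, M, U, P, (hskel p0 hp0).1, hU0, hUs, hPs, hdiv, heq0, hdec, hPM⟩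

theorem closes0E (hBox : SkeletonBoxJ) (hTR : TransverseReduction0E) (hT : RdssProfileTruncation) :
    ¬ _root_.NavierStokesRegularity := by
  obtain ⟨α, C₀, U, Rot, u, -, -, hU2, hU0, hu1, hrss, hmild, hmeas, hC⟩ := boxSelection0E_proof hBox hTR
  have hrdss : Literature.Analysis.FluidPDE.IsRotatedDSS 2 (Rot (-(α * (2 * Real.log 2)))) u := hrss 2 two_pos
  have hnz : ¬ (∀ t < 0, u t =ᵐ[volume] 0) := by
    intro h
    have h1 := h (-1) (by norm_num)
    rw [hu1] at h1
    exact hU0 ((Continuous.ae_eq_iff_eq volume hU2.continuous continuous_const).1 h1)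
  obtain ⟨ν, hν, T, hT, v, q, ⟨hcl, hmax⟩, hLH, hdec⟩ := hT ⟨2, _, _, one_lt_two, hmild, hmeas, hrdss, ⟨C₀, hC⟩, hnz⟩
  intro hA
  have h0 : (0 : ℝ) ∈ Set.Ico 0 T := ⟨le_rfl, hT⟩
  obtain ⟨u', p', hu', hp', hns, hbe⟩ := hA ν hν (v 0) (hcl.contDiff_velocity h0) (hcl.divFree 0 h0) hdec
  have heq : ∀ t ∈ Set.Ico 0 T, u' t = v t :=
    _root_.Summit.NavierStokesRegularity.NavierStokesRegularity.Theorems.blowup_clay_uniqueness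
      ν hν (v 0) hdec u' v p' q T hT hu' hp' hns hbe hcl hLH rfl
  have hcl' : Literature.Analysis.FluidPDE.IsClassicalNSSolutionOn (Set.Ici 0) ν 0 u' p' :=
    ⟨hu', hp', fun t ht x => hns.momentum t ht x, fun t ht => hns.divFree t ht⟩
  refine hmax ⟨T + 1, by linarith, u', p', ?_, heq⟩
  exact hcl'.mono (fun t ht => ht.1) (uniqueDiffOn_Ico 0 (T + 1))

/-! ## Variant A1α — answer to idea-crit-7 g2 PRICE (a), second form: ONE skeleton, and the profile's rotation RATE is an unknown of the
reduction (`∃ α₁ ≠ 0`), as for every relative equilibrium: the e₃-rotation cokernel is met by the internal Lyapunov–Schmidt parameter α₁,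
no box needed — the honest minimal pair if the cokernel ledger shows every other direction is disposed of by identity. -/

/-- crux (rank 3, Variant A1α): unforced transverse reduction at a single skeleton with FREE rotation rate. -/
def TransverseReduction1A : Prop :=
(open Literature.Analysis.FluidPDE in ∀ (N:ℕ) (δ ρ K Λ a b cnd η Rw Rb cg θ₀:ℝ), 0 < N → 0 < δ → 0 < ρ → 0 ≤ a → 0 < η → 0 < Rw → 0 < Rb → 0 < cg → 0 < θ₀ → ∃ Γ₁:ℝ, ∀ Γ:ℝ, Γ₁≤Γ → ∀ (γ:Fin N → ℝ) (α:ℝ) (X:Fin N → ℝ → EuclideanSpace ℝ (Fin 3)) (w:Fin N → ℝ → ℝ) (c:Fin N → ℝ) (m n:Fin N → EuclideanSpace ℝ (Fin 3)) (Aa:Fin N → ℝ → ℝ) (u:(Fin N → ℝ → EuclideanSpace ℝ (Fin 3)) → EuclideanSpace ℝ (Fin 3) → EuclideanSpace ℝ (Fin 3)) (v:EuclideanSpace ℝ (Fin 3) → EuclideanSpace ℝ (Fin 3)) (A:Fin N → (EuclideanSpace ℝ (Fin 3) →L[ℝ] EuclideanSpace ℝ (Fin 3))) (T:(Fin N → ℝ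 → EuclideanSpace ℝ (Fin 3)) → Fin N → ℝ → EuclideanSpace ℝ (Fin 3)), (∀ Z y, u Z y = ∑ k, (Γ*γ k/(4*Real.pi))•∫ σ:ℝ, ((‖y-Z k σ‖^2+Real.exp (-(1+Real.eulerMascheroniConstant-Real.log 2))*Aa k σ)^(3/2:ℝ))⁻¹•cross (deriv (Z k) σ) (y-Z k σ))→(∀ y, v y = u X y+(1/2:ℝ)•y-α•cross (EuclideanSpace.single 2 1) y)→(∀ j, A j = fderiv ℝ v (X j (c j)))→(∀ Z j τ, T Z j τ = (u Z (Z j τ)+(1/2:ℝ)•Z j τ-α•cross (EuclideanSpace.single 2 1) (Z j τ))-(⟪u Z (Z j τ)+(1/2:ℝ)•Z j τ-α•cross (EuclideanSpace.single 2 1) (Z j τ), deriv (Z j) τ⟫_ℝ/‖deriv (Z j) τ‖^2)•deriv (Z j) τ)→((α ≠ 0 ∧ (∀ j, γ j ≠ 0)∧(∀ j, ContDiff ℝ 2 (X j) ∧ Differentiable ℝ (w j)∧(∀ τ, ‖deriv (X j) τ‖ = 1)∧(∀ τ, ‖iteratedDeriv 2 (X j) τ‖*√Γ≤K) ∧ Tendsto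 (fun τ => ‖X j τ‖) (cocompact ℝ) atTop)∧(∀ j k, j ≠ k → ∀ τ σ, ρ*√Γ≤‖X j τ-X k σ‖)∧(∀ j τ σ, ρ*√Γ≤|τ-σ| → cg*ρ*√Γ≤‖X j τ-X j σ‖)∧(∀ j τ, cg*|τ-c j|≤Rw*√Γ+‖X j τ‖)∧(∀ j τ, w j τ = ⟪v (X j τ), deriv (X j) τ⟫_ℝ)∧(∀ j τ, ‖X j τ‖≤Rb*√(Γ*Real.log Γ) → v (X j τ) = w j τ•deriv (X j) τ)∧(∀ j, ‖X j (c j)‖≤Rw*√Γ)∧(∀ j, |⟪deriv (X j) (c j), EuclideanSpace.single 2 1⟫_ℝ|≤1-θ₀)∧(θ₀≤|α| ∧ |α|≤θ₀⁻¹ ∧ ∀ j, θ₀≤|γ j| ∧ |γ j|≤θ₀⁻¹)∧(∀ j, w j (c j) = 0 ∧ (∀ τ, w j τ = 0 → τ = c j) ∧ 3/2+δ≤deriv (w j) (c j) ∧ deriv (w j) (c j)≤Λ)∧(∀ j, Differentiable ℝ (Aa j) ∧ (∀ τ, 0 < Aa j τ) ∧ ∀ τ, w j τ*deriv (Aa j)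 τ = (3/2-deriv (w j) τ)*Aa j τ+4)∧(∀ j, Orthonormal ℝ ![deriv (X j) (c j), m j, n j] ∧ ⟪A j (m j), m j⟫_ℝ+⟪A j (n j), n j⟫_ℝ < 0 ∧ ⟪A j (n j), m j⟫_ℝ * ⟪A j (m j), n j⟫_ℝ < ⟪A j (m j), m j⟫_ℝ * ⟪A j (n j), n j⟫_ℝ)∧(∀ Y:Fin N → ℝ → EuclideanSpace ℝ (Fin 3), (∀ j, ContDiff ℝ 2 (Y j))→(∀ j τ, ⟪Y j τ, deriv (X j) τ⟫_ℝ = 0) → (∀ j τ, Rb*√(Γ*Real.log Γ) < ‖X j τ‖ → Y j τ = 0) → ∑ j, ⟪Y j (c j), cross (EuclideanSpace.single 2 1) (X j (c j))⟫_ℝ = 0 → (∀ j τ, ‖Y j τ‖+‖deriv (Y j) τ‖+‖iteratedDeriv 2 (Y j) τ‖≤(1+|τ-c j|)^b) → ∀ L:ℝ, (∀ j τ, ‖deriv (fun s:ℝ => T (fun k σ => X k σ+s•Y k σ) j τ) 0‖≤L*(1+|τ-c j|)^a) → ∀ j τ, ‖Y j τ‖≤cnd*L*(1+|τ-c j|)^b)))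 → ∃ (α₁ C₀ M:ℝ) (U:EuclideanSpace ℝ (Fin 3) → EuclideanSpace ℝ (Fin 3)) (P:EuclideanSpace ℝ (Fin 3) → ℝ), (α₁ ≠ 0 ∧ U ≠ 0 ∧ ContDiff ℝ (⊤:ℕ∞) U ∧ ContDiff ℝ (⊤:ℕ∞) P ∧ VectorCalculus.IsDivFree U∧(∀ y, α₁•(cross (EuclideanSpace.single 2 1) (U y)-fderiv ℝ U y (cross (EuclideanSpace.single 2 1) y))+(1/2:ℝ)•U y+(1/2:ℝ)•fderiv ℝ U y y-(Laplacian.laplacian U) y+fderiv ℝ U y (U y)+gradient P y = 0)∧(∀ y, ‖U y‖≤C₀/(1+‖y‖))∧(∀ y, |P y|≤M)∧(∀ y, ‖y‖≤Rw*√Γ → (∀ j τ, ρ*√Γ/4≤‖y-X j τ‖) → ‖U y-u X y‖≤η*√Γ)))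

/-- glue (provable now, Variant A1α). -/
def Selection1A : Prop :=
  SkeletonJ1 → TransverseReduction1A → RssProfileExists

theorem selection1A_proof : Selection1A := by
  unfold Selection1A
  intro hbox hred
  classical
  obtain ⟨N, δ, ρ, K, Λ, a, b, cnd, η, Rw, Rb, cg, θ₀, Γ₂, hN, hδ, hρ, ha, _hcnd, hη, hRw, hRb, hcg, hθ₀, hbox⟩ :=
    hbox
  obtain ⟨Γ₁, hred⟩ := hred N δ ρ K Λ a b cnd η Rw Rb cg θ₀ hN hδ hρ ha hη hRw hRb hcg hθ₀
  obtain ⟨γ, α, X, w, c, m, n, Aa, hfam⟩ := hbox (max Γ₁ Γ₂) (le_max_right _ _)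
  set Γ : ℝ := max Γ₁ Γ₂
  set u : (Fin N → ℝ → EuclideanSpace ℝ (Fin 3)) → EuclideanSpace ℝ (Fin 3) → EuclideanSpace ℝ (Fin 3) :=
    fun Z y => ∑ k : Fin N, (Γ * γ k / (4 * π)) • ∫ σ : ℝ,
        ((‖y - Z k σ‖ ^ 2 + Real.exp (-(1 + Real.eulerMascheroniConstant - Real.log 2)) * Aa k σ) ^ (3 / 2 : ℝ))⁻¹ •
          cross (deriv (Z k) σ) (y - Z k σ)
  set v : EuclideanSpace ℝ (Fin 3) → EuclideanSpace ℝ (Fin 3) :=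
    fun y => u X y + (1 / 2 : ℝ) • y - α • cross (EuclideanSpace.single (2 : Fin 3) (1 : ℝ)) y
  set A : Fin N → (EuclideanSpace ℝ (Fin 3) →L[ℝ] EuclideanSpace ℝ (Fin 3)) := fun j => fderiv ℝ v (X j (c j))
  set T : (Fin N → ℝ → EuclideanSpace ℝ (Fin 3)) → Fin N → ℝ → EuclideanSpace ℝ (Fin 3) :=
    fun Z j τ => (u Z (Z j τ) + (1 / 2 : ℝ) • Z j τ - α • cross (EuclideanSpace.single (2 : Fin 3) (1 : ℝ)) (Z j τ)) -
      (inner ℝ (u Z (Z j τ) + (1 / 2 : ℝ) • Z j τ - α • cross (EuclideanSpace.single (2 : Fin 3) (1 : ℝ)) (Z j τ)) (deriv (Z j) τ) /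
        ‖deriv (Z j) τ‖ ^ 2) • deriv (Z j) τ
  have hskel := hfam u v A T (fun _ _ => rfl) (fun _ => rfl) (fun _ => rfl) (fun _ _ _ => rfl)
  obtain ⟨α₁, C₀, M, U, P, hα₁, hU0, hUs, hPs, hdiv, heq, hdec, hPM, -⟩ := hred Γ (le_max_left _ _) γ α X w c m n Aa u v A T
    (fun _ _ => rfl) (fun _ => rfl) (fun _ => rfl) (fun _ _ _ => rfl) hskel
  have heq0 : ∀ y : EuclideanSpace ℝ (Fin 3), α₁ • (rotGen (U y) - fderiv ℝ U y (rotGen y)) +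
      (1 / 2 : ℝ) • U y + (1 / 2 : ℝ) • fderiv ℝ U y y - (Δ U) y + fderiv ℝ U y (U y) + gradient P y = 0 := by
    intro y
    simp only [splitGlue_rotGen_eq_cross_single_two]
    exact heq y
  exact stub_rssProfileExists_of_profile ⟨α₁, C₀, M, U, P, hα₁, hU0, hUs, hPs, hdiv, heq0, hdec, hPM⟩

theorem closes1A (hSk : SkeletonJ1) (hTR : TransverseReduction1A) (hT : RdssProfileTruncation) :
    ¬ _root_.NavierStokesRegularity := by
  obtain ⟨α, C₀, U, Rot, u, -, -, hU2, hU0, hu1, hrss, hmild, hmeas, hC⟩ := selection1A_proof hSk hTR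
  have hrdss : Literature.Analysis.FluidPDE.IsRotatedDSS 2 (Rot (-(α * (2 * Real.log 2)))) u := hrss 2 two_pos
  have hnz : ¬ (∀ t < 0, u t =ᵐ[volume] 0) := by
    intro h
    have h1 := h (-1) (by norm_num)
    rw [hu1] at h1
    exact hU0 ((Continuous.ae_eq_iff_eq volume hU2.continuous continuous_const).1 h1)
  obtain ⟨ν, hν, T, hT, v, q, ⟨hcl, hmax⟩, hLH, hdec⟩ := hT ⟨2, _, _, one_lt_two, hmild, hmeas, hrdss, ⟨C₀, hC⟩, hnz⟩
  intro hA
  have h0 : (0 : ℝ) ∈ Set.Ico 0 T := ⟨le_rfl, hT⟩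
  obtain ⟨u', p', hu', hp', hns, hbe⟩ := hA ν hν (v 0) (hcl.contDiff_velocity h0) (hcl.divFree 0 h0) hdec
  have heq : ∀ t ∈ Set.Ico 0 T, u' t = v t :=
    _root_.Summit.NavierStokesRegularity.NavierStokesRegularity.Theorems.blowup_clay_uniqueness
      ν hν (v 0) hdec u' v p' q T hT hu' hp' hns hbe hcl hLH rfl
  have hcl' : Literature.Analysis.FluidPDE.IsClassicalNSSolutionOn (Set.Ici 0) ν 0 u' p' :=
    ⟨hu', hp', fun t ht x => hns.momentum t ht x, fun t ht => hns.divFree t ht⟩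
  refine hmax ⟨T + 1, by linarith, u', p', ?_, heq⟩
  exact hcl'.mono (fun t ht => ht.1) (uniqueDiffOn_Ico 0 (T + 1))

/-! ## VARIANT A1T (rev 3, 2026-08-28, after MODEL job j306611 KILL-1 «MATCHED-KERNEL DATUM LOST»)
A1α plus ONE clause, the CONE-THINNESS clause (CT), inserted right after the core-area law (d7) on BOTH sides:
`(∀ j τ, ‖X j τ‖ ≤ Rw*√Γ → exp(−(1+γ_E−log 2))·Aa j τ ≤ (ρ/8)^2·Γ)` — inside the working ball the matched Gaussian core
radius μ_j(τ) = √(0.41307·Aa j τ) is at most HALF the exclusion-tube radius ρ√Γ/4 off which closeness is measured.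
Why: along any arm reaching the dilation regime (w ~ τ/2, w′ → 1/2) the area law forces Aa ~ θ²τ² (a CONE of angle θ, fixed
physical core ⇒ similarity core ∝ e^(σ/2)); thin-filament asymptotics (and the reduction 1A) need θ small; without (CT) the
skeleton crux admits fat-cone inhabitants (j306611: θ₊ ≈ 1.5 on the + arm of the R_π datum) on which a thin-core transverse
reduction is meaningless. (CT) is ∃-side content (the skeleton prover must exhibit a thin-cone skeleton) and a hypothesis of the
reduction; the glue is unchanged (clause lists identical on both sides). -/

/-- crux (rank 2, Variant A1T): SkeletonJ1 + cone-thinness clause (CT). -/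
def SkeletonJ1T : Prop :=
(open Literature.Analysis.FluidPDE in ∃ (N:ℕ) (δ ρ K Λ a b cnd η Rw Rb cg θ₀ Γ₂:ℝ), 0 < N ∧ 0 < δ ∧ 0 < ρ ∧ 0 ≤ a ∧ 0 < cnd ∧ 0 < η ∧ 0 < Rw ∧ 0 < Rb ∧ 0 < cg ∧ 0 < θ₀ ∧ ∀ Γ:ℝ, Γ₂≤Γ → ∃ (γ:Fin N → ℝ) (α:ℝ) (X:Fin N → ℝ → EuclideanSpace ℝ (Fin 3)) (w:Fin N → ℝ → ℝ) (c:Fin N → ℝ) (m n:Fin N → EuclideanSpace ℝ (Fin 3)) (Aa:Fin N → ℝ → ℝ), ∀ (u:(Fin N → ℝ → EuclideanSpace ℝ (Fin 3)) → EuclideanSpace ℝ (Fin 3) → EuclideanSpace ℝ (Fin 3)) (v:EuclideanSpace ℝ (Fin 3) → EuclideanSpace ℝ (Fin 3)) (A:Fin N → (EuclideanSpace ℝ (Fin 3) →L[ℝ] EuclideanSpace ℝ (Fin 3))) (T:(Fin N → ℝ → EuclideanSpace ℝ (Fin 3)) → Fin N → ℝ → EuclideanSpace ℝ (Fin 3)),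 (∀ Z y, u Z y = ∑ k, (Γ*γ k/(4*Real.pi))•∫ σ:ℝ, ((‖y-Z k σ‖^2+Real.exp (-(1+Real.eulerMascheroniConstant-Real.log 2))*Aa k σ)^(3/2:ℝ))⁻¹•cross (deriv (Z k) σ) (y-Z k σ))→(∀ y, v y = u X y+(1/2:ℝ)•y-α•cross (EuclideanSpace.single 2 1) y)→(∀ j, A j = fderiv ℝ v (X j (c j)))→(∀ Z j τ, T Z j τ = (u Z (Z j τ)+(1/2:ℝ)•Z j τ-α•cross (EuclideanSpace.single 2 1) (Z j τ))-(⟪u Z (Z j τ)+(1/2:ℝ)•Z j τ-α•cross (EuclideanSpace.single 2 1) (Z j τ), deriv (Z j) τ⟫_ℝ/‖deriv (Z j) τ‖^2)•deriv (Z j) τ)→((α ≠ 0 ∧ (∀ j, γ j ≠ 0)∧(∀ j, ContDiff ℝ 2 (X j) ∧ Differentiable ℝ (w j)∧(∀ τ, ‖deriv (X j) τ‖ = 1)∧(∀ τ, ‖iteratedDeriv 2 (X j) τ‖*√Γ≤K) ∧ Tendsto (fun τ => ‖X j τ‖) (cocompact ℝ) atTop)∧(∀ j k, j ≠ k → ∀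 τ σ, ρ*√Γ≤‖X j τ-X k σ‖)∧(∀ j τ σ, ρ*√Γ≤|τ-σ| → cg*ρ*√Γ≤‖X j τ-X j σ‖)∧(∀ j τ, cg*|τ-c j|≤Rw*√Γ+‖X j τ‖)∧(∀ j τ, w j τ = ⟪v (X j τ), deriv (X j) τ⟫_ℝ)∧(∀ j τ, ‖X j τ‖≤Rb*√(Γ*Real.log Γ) → v (X j τ) = w j τ•deriv (X j) τ)∧(∀ j, ‖X j (c j)‖≤Rw*√Γ)∧(∀ j, |⟪deriv (X j) (c j), EuclideanSpace.single 2 1⟫_ℝ|≤1-θ₀)∧(θ₀≤|α| ∧ |α|≤θ₀⁻¹ ∧ ∀ j, θ₀≤|γ j| ∧ |γ j|≤θ₀⁻¹)∧(∀ j, w j (c j) = 0 ∧ (∀ τ, w j τ = 0 → τ = c j) ∧ 3/2+δ≤deriv (w j) (c j) ∧ deriv (w j) (c j)≤Λ)∧(∀ j, Differentiable ℝ (Aa j) ∧ (∀ τ, 0 < Aa j τ) ∧ ∀ τ, w j τ*deriv (Aa j) τ = (3/2-deriv (w j) τ)*Aa j τ+4)∧(∀ j τ, ‖X j τ‖≤Rw*√Γ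 → Real.exp (-(1+Real.eulerMascheroniConstant-Real.log 2))*Aa j τ≤(ρ/8)^2*Γ)∧(∀ j, Orthonormal ℝ ![deriv (X j) (c j), m j, n j] ∧ ⟪A j (m j), m j⟫_ℝ+⟪A j (n j), n j⟫_ℝ < 0 ∧ ⟪A j (n j), m j⟫_ℝ * ⟪A j (m j), n j⟫_ℝ < ⟪A j (m j), m j⟫_ℝ * ⟪A j (n j), n j⟫_ℝ)∧(∀ Y:Fin N → ℝ → EuclideanSpace ℝ (Fin 3), (∀ j, ContDiff ℝ 2 (Y j))→(∀ j τ, ⟪Y j τ, deriv (X j) τ⟫_ℝ = 0) → (∀ j τ, Rb*√(Γ*Real.log Γ) < ‖X j τ‖ → Y j τ = 0) → ∑ j, ⟪Y j (c j), cross (EuclideanSpace.single 2 1) (X j (c j))⟫_ℝ = 0 → (∀ j τ, ‖Y j τ‖+‖deriv (Y j) τ‖+‖iteratedDeriv 2 (Y j) τ‖≤(1+|τ-c j|)^b) → ∀ L:ℝ, (∀ j τ, ‖deriv (fun s:ℝ => T (fun k σ => X k σ+s•Y k σ) j τ) 0‖≤L*(1+|τ-c j|)^a) → ∀ j τ, ‖Y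 j τ‖≤cnd*L*(1+|τ-c j|)^b))))

/-- crux (rank 3, Variant A1T): TransverseReduction1A with (CT) among the skeleton hypotheses. -/
def TransverseReduction1AT : Prop :=
(open Literature.Analysis.FluidPDE in ∀ (N:ℕ) (δ ρ K Λ a b cnd η Rw Rb cg θ₀:ℝ), 0 < N → 0 < δ → 0 < ρ → 0 ≤ a → 0 < η → 0 < Rw → 0 < Rb → 0 < cg → 0 < θ₀ → ∃ Γ₁:ℝ, ∀ Γ:ℝ, Γ₁≤Γ → ∀ (γ:Fin N → ℝ) (α:ℝ) (X:Fin N → ℝ → EuclideanSpace ℝ (Fin 3)) (w:Fin N → ℝ → ℝ) (c:Fin N → ℝ) (m n:Fin N → EuclideanSpace ℝ (Fin 3)) (Aa:Fin N → ℝ → ℝ) (u:(Fin N → ℝ → EuclideanSpace ℝ (Fin 3)) → EuclideanSpace ℝ (Fin 3) → EuclideanSpace ℝ (Fin 3)) (v:EuclideanSpace ℝ (Fin 3) → EuclideanSpace ℝ (Fin 3)) (A:Fin N → (EuclideanSpace ℝ (Fin 3) →L[ℝ] EuclideanSpace ℝ (Fin 3))) (T:(Fin N → ℝ → EuclideanSpace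 ℝ (Fin 3)) → Fin N → ℝ → EuclideanSpace ℝ (Fin 3)), (∀ Z y, u Z y = ∑ k, (Γ*γ k/(4*Real.pi))•∫ σ:ℝ, ((‖y-Z k σ‖^2+Real.exp (-(1+Real.eulerMascheroniConstant-Real.log 2))*Aa k σ)^(3/2:ℝ))⁻¹•cross (deriv (Z k) σ) (y-Z k σ))→(∀ y, v y = u X y+(1/2:ℝ)•y-α•cross (EuclideanSpace.single 2 1) y)→(∀ j, A j = fderiv ℝ v (X j (c j)))→(∀ Z j τ, T Z j τ = (u Z (Z j τ)+(1/2:ℝ)•Z j τ-α•cross (EuclideanSpace.single 2 1) (Z j τ))-(⟪u Z (Z j τ)+(1/2:ℝ)•Z j τ-α•cross (EuclideanSpace.single 2 1) (Z j τ), deriv (Z j) τ⟫_ℝ/‖deriv (Z j) τ‖^2)•deriv (Z j) τ)→((α ≠ 0 ∧ (∀ j, γ j ≠ 0)∧(∀ j, ContDiff ℝ 2 (X j) ∧ Differentiable ℝ (w j)∧(∀ τ, ‖deriv (X j) τ‖ = 1)∧(∀ τ, ‖iteratedDeriv 2 (X j) τ‖*√Γ≤K) ∧ Tendsto (fun τ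 => ‖X j τ‖) (cocompact ℝ) atTop)∧(∀ j k, j ≠ k → ∀ τ σ, ρ*√Γ≤‖X j τ-X k σ‖)∧(∀ j τ σ, ρ*√Γ≤|τ-σ| → cg*ρ*√Γ≤‖X j τ-X j σ‖)∧(∀ j τ, cg*|τ-c j|≤Rw*√Γ+‖X j τ‖)∧(∀ j τ, w j τ = ⟪v (X j τ), deriv (X j) τ⟫_ℝ)∧(∀ j τ, ‖X j τ‖≤Rb*√(Γ*Real.log Γ) → v (X j τ) = w j τ•deriv (X j) τ)∧(∀ j, ‖X j (c j)‖≤Rw*√Γ)∧(∀ j, |⟪deriv (X j) (c j), EuclideanSpace.single 2 1⟫_ℝ|≤1-θ₀)∧(θ₀≤|α| ∧ |α|≤θ₀⁻¹ ∧ ∀ j, θ₀≤|γ j| ∧ |γ j|≤θ₀⁻¹)∧(∀ j, w j (c j) = 0 ∧ (∀ τ, w j τ = 0 → τ = c j) ∧ 3/2+δ≤deriv (w j) (c j) ∧ deriv (w j) (c j)≤Λ)∧(∀ j, Differentiable ℝ (Aa j) ∧ (∀ τ, 0 < Aa j τ) ∧ ∀ τ, w j τ*deriv (Aa j) τ = (3/2-deriv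 (w j) τ)*Aa j τ+4)∧(∀ j τ, ‖X j τ‖≤Rw*√Γ → Real.exp (-(1+Real.eulerMascheroniConstant-Real.log 2))*Aa j τ≤(ρ/8)^2*Γ)∧(∀ j, Orthonormal ℝ ![deriv (X j) (c j), m j, n j] ∧ ⟪A j (m j), m j⟫_ℝ+⟪A j (n j), n j⟫_ℝ < 0 ∧ ⟪A j (n j), m j⟫_ℝ * ⟪A j (m j), n j⟫_ℝ < ⟪A j (m j), m j⟫_ℝ * ⟪A j (n j), n j⟫_ℝ)∧(∀ Y:Fin N → ℝ → EuclideanSpace ℝ (Fin 3), (∀ j, ContDiff ℝ 2 (Y j))→(∀ j τ, ⟪Y j τ, deriv (X j) τ⟫_ℝ = 0) → (∀ j τ, Rb*√(Γ*Real.log Γ) < ‖X j τ‖ → Y j τ = 0) → ∑ j, ⟪Y j (c j), cross (EuclideanSpace.single 2 1) (X j (c j))⟫_ℝ = 0 → (∀ j τ, ‖Y j τ‖+‖deriv (Y j) τ‖+‖iteratedDeriv 2 (Y j) τ‖≤(1+|τ-c j|)^b) → ∀ L:ℝ, (∀ j τ, ‖deriv (fun s:ℝ => T (fun k σ => X k σ+s•Y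 k σ) j τ) 0‖≤L*(1+|τ-c j|)^a) → ∀ j τ, ‖Y j τ‖≤cnd*L*(1+|τ-c j|)^b))) → ∃ (α₁ C₀ M:ℝ) (U:EuclideanSpace ℝ (Fin 3) → EuclideanSpace ℝ (Fin 3)) (P:EuclideanSpace ℝ (Fin 3) → ℝ), (α₁ ≠ 0 ∧ U ≠ 0 ∧ ContDiff ℝ (⊤:ℕ∞) U ∧ ContDiff ℝ (⊤:ℕ∞) P ∧ VectorCalculus.IsDivFree U∧(∀ y, α₁•(cross (EuclideanSpace.single 2 1) (U y)-fderiv ℝ U y (cross (EuclideanSpace.single 2 1) y))+(1/2:ℝ)•U y+(1/2:ℝ)•fderiv ℝ U y y-(Laplacian.laplacian U) y+fderiv ℝ U y (U y)+gradient P y = 0)∧(∀ y, ‖U y‖≤C₀/(1+‖y‖))∧(∀ y, |P y|≤M)∧(∀ y, ‖y‖≤Rw*√Γ → (∀ j τ, ρ*√Γ/4≤‖y-X j τ‖) → ‖U y-u X y‖≤η*√Γ)))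

/-- glue (provable now, Variant A1T). -/
def Selection1AT : Prop :=
  SkeletonJ1T → TransverseReduction1AT → RssProfileExists

theorem selection1AT_proof : Selection1AT := by
  unfold Selection1AT
  intro hbox hred
  classical
  obtain ⟨N, δ, ρ, K, Λ, a, b, cnd, η, Rw, Rb, cg, θ₀, Γ₂, hN, hδ, hρ, ha, _hcnd, hη, hRw, hRb, hcg, hθ₀, hbox⟩ :=
    hbox
  obtain ⟨Γ₁, hred⟩ := hred N δ ρ K Λ a b cnd η Rw Rb cg θ₀ hN hδ hρ ha hη hRw hRb hcg hθ₀
  obtain ⟨γ, α, X, w, c, m, n, Aa, hfam⟩ := hbox (max Γ₁ Γ₂) (le_max_right _ _)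
  set Γ : ℝ := max Γ₁ Γ₂
  set u : (Fin N → ℝ → EuclideanSpace ℝ (Fin 3)) → EuclideanSpace ℝ (Fin 3) → EuclideanSpace ℝ (Fin 3) :=
    fun Z y => ∑ k : Fin N, (Γ * γ k / (4 * π)) • ∫ σ : ℝ,
        ((‖y - Z k σ‖ ^ 2 + Real.exp (-(1 + Real.eulerMascheroniConstant - Real.log 2)) * Aa k σ) ^ (3 / 2 : ℝ))⁻¹ •
          cross (deriv (Z k) σ) (y - Z k σ)
  set v : EuclideanSpace ℝ (Fin 3) → EuclideanSpace ℝ (Fin 3) :=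
    fun y => u X y + (1 / 2 : ℝ) • y - α • cross (EuclideanSpace.single (2 : Fin 3) (1 : ℝ)) y
  set A : Fin N → (EuclideanSpace ℝ (Fin 3) →L[ℝ] EuclideanSpace ℝ (Fin 3)) := fun j => fderiv ℝ v (X j (c j))
  set T : (Fin N → ℝ → EuclideanSpace ℝ (Fin 3)) → Fin N → ℝ → EuclideanSpace ℝ (Fin 3) :=
    fun Z j τ => (u Z (Z j τ) + (1 / 2 : ℝ) • Z j τ - α • cross (EuclideanSpace.single (2 : Fin 3) (1 : ℝ)) (Z j τ)) -
      (inner ℝ (u Z (Z j τ) + (1 / 2 : ℝ) • Z j τ - α • cross (EuclideanSpace.single (2 : Fin 3) (1 : ℝ)) (Z j τ)) (deriv (Z j) τ) /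
        ‖deriv (Z j) τ‖ ^ 2) • deriv (Z j) τ
  have hskel := hfam u v A T (fun _ _ => rfl) (fun _ => rfl) (fun _ => rfl) (fun _ _ _ => rfl)
  obtain ⟨α₁, C₀, M, U, P, hα₁, hU0, hUs, hPs, hdiv, heq, hdec, hPM, -⟩ := hred Γ (le_max_left _ _) γ α X w c m n Aa u v A T
    (fun _ _ => rfl) (fun _ => rfl) (fun _ => rfl) (fun _ _ _ => rfl) hskel
  have heq0 : ∀ y : EuclideanSpace ℝ (Fin 3), α₁ • (rotGen (U y) - fderiv ℝ U y (rotGen y)) +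
      (1 / 2 : ℝ) • U y + (1 / 2 : ℝ) • fderiv ℝ U y y - (Δ U) y + fderiv ℝ U y (U y) + gradient P y = 0 := by
    intro y
    simp only [splitGlue_rotGen_eq_cross_single_two]
    exact heq y
  exact stub_rssProfileExists_of_profile ⟨α₁, C₀, M, U, P, hα₁, hU0, hUs, hPs, hdiv, heq0, hdec, hPM⟩

theorem closes1AT (hSk : SkeletonJ1T) (hTR : TransverseReduction1AT) (hT : RdssProfileTruncation) :
    ¬ _root_.NavierStokesRegularity := by
  obtain ⟨α, C₀, U, Rot, u, -, -, hU2, hU0, hu1, hrss, hmild, hmeas, hC⟩ := selection1AT_proof hSk hTR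
  have hrdss : Literature.Analysis.FluidPDE.IsRotatedDSS 2 (Rot (-(α * (2 * Real.log 2)))) u := hrss 2 two_pos
  have hnz : ¬ (∀ t < 0, u t =ᵐ[volume] 0) := by
    intro h
    have h1 := h (-1) (by norm_num)
    rw [hu1] at h1
    exact hU0 ((Continuous.ae_eq_iff_eq volume hU2.continuous continuous_const).1 h1)
  obtain ⟨ν, hν, T, hT, v, q, ⟨hcl, hmax⟩, hLH, hdec⟩ := hT ⟨2, _, _, one_lt_two, hmild, hmeas, hrdss, ⟨C₀, hC⟩, hnz⟩
  intro hA
  have h0 : (0 : ℝ) ∈ Set.Ico 0 T := ⟨le_rfl, hT⟩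
  obtain ⟨u', p', hu', hp', hns, hbe⟩ := hA ν hν (v 0) (hcl.contDiff_velocity h0) (hcl.divFree 0 h0) hdec
  have heq : ∀ t ∈ Set.Ico 0 T, u' t = v t :=
    _root_.Summit.NavierStokesRegularity.NavierStokesRegularity.Theorems.blowup_clay_uniqueness
      ν hν (v 0) hdec u' v p' q T hT hu' hp' hns hbe hcl hLH rfl
  have hcl' : Literature.Analysis.FluidPDE.IsClassicalNSSolutionOn (Set.Ici 0) ν 0 u' p' :=
    ⟨hu', hp', fun t ht x => hns.momentum t ht x, fun t ht => hns.divFree t ht⟩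
  refine hmax ⟨T + 1, by linarith, u', p', ?_, heq⟩
  exact hcl'.mono (fun t ht => ht.1) (uniqueDiffOn_Ico 0 (T + 1))


/-! ## VARIANT A1F (rev 3.1, 2026-08-28) — A1α plus the Γ-UNIFORM in-ball core bound (CT-flat)
One more ∃/∀ constant `KA` and ONE clause after (d7) on both sides: `(∀ j τ, ‖X j τ‖ ≤ Rw*√Γ → Aa j τ ≤ KA)`.
Physics: inside the working ball the matched core area is set by the corner law A(c) = 4/(w′(c) − 3/2) ≤ 4/δ and O(1) transport,
hence Γ-FLAT (j306611 it0: μ_max in the tangency ball 15.8 → 12.9 from Γ = 1e4 to 1e5 while √Γ grew ×3.16); (CT-flat) records exactly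
that and hands the reduction genuinely thin cores (μ ≤ √(0.41307·KA) = O(1) against tube radius ρ√Γ/4 → ∞), i.e. the same asymptotic
regime as the frozen '+1' kernel had for free. (CT-flat) implies (CT) of Variant A1T for Γ ≥ 64·0.41307·KA/ρ². Glue: the proof only threads
the extra binder. -/

/-- crux (rank 2, Variant A1F): SkeletonJ1 + Γ-uniform in-ball core-area bound (CT-flat), extra constant KA. -/
def SkeletonJ1F : Prop :=
(open Literature.Analysis.FluidPDE in ∃ (N:ℕ) (δ ρ K Λ a b cnd η Rw Rb cg θ₀ KA Γ₂:ℝ), 0 < N ∧ 0 < δ ∧ 0 < ρ ∧ 0 ≤ a ∧ 0 < cnd ∧ 0 < η ∧ 0 < Rw ∧ 0 < Rb ∧ 0 < cg ∧ 0 < θ₀ ∧ ∀ Γ:ℝ, Γ₂≤Γ → ∃ (γ:Fin N → ℝ) (α:ℝ) (X:Fin N → ℝ → EuclideanSpace ℝ (Fin 3)) (w:Fin N → ℝ → ℝ) (c:Fin N → ℝ) (m n:Fin N → EuclideanSpace ℝ (Fin 3)) (Aa:Fin N → ℝ → ℝ), ∀ (u:(Fin N → ℝ → EuclideanSpace ℝ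 (Fin 3)) → EuclideanSpace ℝ (Fin 3) → EuclideanSpace ℝ (Fin 3)) (v:EuclideanSpace ℝ (Fin 3) → EuclideanSpace ℝ (Fin 3)) (A:Fin N → (EuclideanSpace ℝ (Fin 3) →L[ℝ] EuclideanSpace ℝ (Fin 3))) (T:(Fin N → ℝ → EuclideanSpace ℝ (Fin 3)) → Fin N → ℝ → EuclideanSpace ℝ (Fin 3)), (∀ Z y, u Z y = ∑ k, (Γ*γ k/(4*Real.pi))•∫ σ:ℝ, ((‖y-Z k σ‖^2+Real.exp (-(1+Real.eulerMascheroniConstant-Real.log 2))*Aa k σ)^(3/2:ℝ))⁻¹•cross (deriv (Z k) σ) (y-Z k σ))→(∀ y, v y = u X y+(1/2:ℝ)•y-α•cross (EuclideanSpace.single 2 1) y)→(∀ j, A j = fderiv ℝ v (X j (c j)))→(∀ Z j τ, T Z j τ = (u Z (Z j τ)+(1/2:ℝ)•Z j τ-α•cross (EuclideanSpace.single 2 1) (Z j τ))-(⟪u Z (Z j τ)+(1/2:ℝ)•Z j τ-α•cross (EuclideanSpace.single 2 1) (Z j τ), deriv (Z j) τ⟫_ℝ/‖deriv (Z j) τ‖^2)•deriv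 (Z j) τ)→((α ≠ 0 ∧ (∀ j, γ j ≠ 0)∧(∀ j, ContDiff ℝ 2 (X j) ∧ Differentiable ℝ (w j)∧(∀ τ, ‖deriv (X j) τ‖ = 1)∧(∀ τ, ‖iteratedDeriv 2 (X j) τ‖*√Γ≤K) ∧ Tendsto (fun τ => ‖X j τ‖) (cocompact ℝ) atTop)∧(∀ j k, j ≠ k → ∀ τ σ, ρ*√Γ≤‖X j τ-X k σ‖)∧(∀ j τ σ, ρ*√Γ≤|τ-σ| → cg*ρ*√Γ≤‖X j τ-X j σ‖)∧(∀ j τ, cg*|τ-c j|≤Rw*√Γ+‖X j τ‖)∧(∀ j τ, w j τ = ⟪v (X j τ), deriv (X j) τ⟫_ℝ)∧(∀ j τ, ‖X j τ‖≤Rb*√(Γ*Real.log Γ) → v (X j τ) = w j τ•deriv (X j) τ)∧(∀ j, ‖X j (c j)‖≤Rw*√Γ)∧(∀ j, |⟪deriv (X j) (c j), EuclideanSpace.single 2 1⟫_ℝ|≤1-θ₀)∧(θ₀≤|α| ∧ |α|≤θ₀⁻¹ ∧ ∀ j, θ₀≤|γ j| ∧ |γ j|≤θ₀⁻¹)∧(∀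 j, w j (c j) = 0 ∧ (∀ τ, w j τ = 0 → τ = c j) ∧ 3/2+δ≤deriv (w j) (c j) ∧ deriv (w j) (c j)≤Λ)∧(∀ j, Differentiable ℝ (Aa j) ∧ (∀ τ, 0 < Aa j τ) ∧ ∀ τ, w j τ*deriv (Aa j) τ = (3/2-deriv (w j) τ)*Aa j τ+4)∧(∀ j τ, ‖X j τ‖≤Rw*√Γ → Aa j τ≤KA)∧(∀ j, Orthonormal ℝ ![deriv (X j) (c j), m j, n j] ∧ ⟪A j (m j), m j⟫_ℝ+⟪A j (n j), n j⟫_ℝ < 0 ∧ ⟪A j (n j), m j⟫_ℝ * ⟪A j (m j), n j⟫_ℝ < ⟪A j (m j), m j⟫_ℝ * ⟪A j (n j), n j⟫_ℝ)∧(∀ Y:Fin N → ℝ → EuclideanSpace ℝ (Fin 3), (∀ j, ContDiff ℝ 2 (Y j))→(∀ j τ, ⟪Y j τ, deriv (X j) τ⟫_ℝ = 0) → (∀ j τ, Rb*√(Γ*Real.log Γ) < ‖X j τ‖ → Y j τ = 0) → ∑ j, ⟪Y j (c j), cross (EuclideanSpace.single 2 1) (X j (c j))⟫_ℝ = 0 →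 (∀ j τ, ‖Y j τ‖+‖deriv (Y j) τ‖+‖iteratedDeriv 2 (Y j) τ‖≤(1+|τ-c j|)^b) → ∀ L:ℝ, (∀ j τ, ‖deriv (fun s:ℝ => T (fun k σ => X k σ+s•Y k σ) j τ) 0‖≤L*(1+|τ-c j|)^a) → ∀ j τ, ‖Y j τ‖≤cnd*L*(1+|τ-c j|)^b))))

/-- crux (rank 3, Variant A1F): TransverseReduction1A with (CT-flat) among the skeleton hypotheses (∀ KA). -/
def TransverseReduction1AF : Prop :=
(open Literature.Analysis.FluidPDE in ∀ (N:ℕ) (δ ρ K Λ a b cnd η Rw Rb cg θ₀ KA:ℝ), 0 < N → 0 < δ → 0 < ρ → 0 ≤ a → 0 < η → 0 < Rw → 0 < Rb → 0 < cg → 0 < θ₀ → ∃ Γ₁:ℝ, ∀ Γ:ℝ, Γ₁≤Γ → ∀ (γ:Fin N → ℝ) (α:ℝ) (X:Fin N → ℝ → EuclideanSpace ℝ (Fin 3)) (w:Fin N → ℝ → ℝ) (c:Fin N → ℝ) (m n:Fin N → EuclideanSpace ℝ (Fin 3)) (Aa:Fin N → ℝ → ℝ) (u:(Fin N → ℝ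 → EuclideanSpace ℝ (Fin 3)) → EuclideanSpace ℝ (Fin 3) → EuclideanSpace ℝ (Fin 3)) (v:EuclideanSpace ℝ (Fin 3) → EuclideanSpace ℝ (Fin 3)) (A:Fin N → (EuclideanSpace ℝ (Fin 3) →L[ℝ] EuclideanSpace ℝ (Fin 3))) (T:(Fin N → ℝ → EuclideanSpace ℝ (Fin 3)) → Fin N → ℝ → EuclideanSpace ℝ (Fin 3)), (∀ Z y, u Z y = ∑ k, (Γ*γ k/(4*Real.pi))•∫ σ:ℝ, ((‖y-Z k σ‖^2+Real.exp (-(1+Real.eulerMascheroniConstant-Real.log 2))*Aa k σ)^(3/2:ℝ))⁻¹•cross (deriv (Z k) σ) (y-Z k σ))→(∀ y, v y = u X y+(1/2:ℝ)•y-α•cross (EuclideanSpace.single 2 1) y)→(∀ j, A j = fderiv ℝ v (X j (c j)))→(∀ Z j τ, T Z j τ = (u Z (Z j τ)+(1/2:ℝ)•Z j τ-α•cross (EuclideanSpace.single 2 1) (Z j τ))-(⟪u Z (Z j τ)+(1/2:ℝ)•Z j τ-α•cross (EuclideanSpace.single 2 1) (Z j τ), deriv (Z j) τ⟫_ℝ/‖deriv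 (Z j) τ‖^2)•deriv (Z j) τ)→((α ≠ 0 ∧ (∀ j, γ j ≠ 0)∧(∀ j, ContDiff ℝ 2 (X j) ∧ Differentiable ℝ (w j)∧(∀ τ, ‖deriv (X j) τ‖ = 1)∧(∀ τ, ‖iteratedDeriv 2 (X j) τ‖*√Γ≤K) ∧ Tendsto (fun τ => ‖X j τ‖) (cocompact ℝ) atTop)∧(∀ j k, j ≠ k → ∀ τ σ, ρ*√Γ≤‖X j τ-X k σ‖)∧(∀ j τ σ, ρ*√Γ≤|τ-σ| → cg*ρ*√Γ≤‖X j τ-X j σ‖)∧(∀ j τ, cg*|τ-c j|≤Rw*√Γ+‖X j τ‖)∧(∀ j τ, w j τ = ⟪v (X j τ), deriv (X j) τ⟫_ℝ)∧(∀ j τ, ‖X j τ‖≤Rb*√(Γ*Real.log Γ) → v (X j τ) = w j τ•deriv (X j) τ)∧(∀ j, ‖X j (c j)‖≤Rw*√Γ)∧(∀ j, |⟪deriv (X j) (c j), EuclideanSpace.single 2 1⟫_ℝ|≤1-θ₀)∧(θ₀≤|α| ∧ |α|≤θ₀⁻¹ ∧ ∀ j, θ₀≤|γ j| ∧ |γ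 j|≤θ₀⁻¹)∧(∀ j, w j (c j) = 0 ∧ (∀ τ, w j τ = 0 → τ = c j) ∧ 3/2+δ≤deriv (w j) (c j) ∧ deriv (w j) (c j)≤Λ)∧(∀ j, Differentiable ℝ (Aa j) ∧ (∀ τ, 0 < Aa j τ) ∧ ∀ τ, w j τ*deriv (Aa j) τ = (3/2-deriv (w j) τ)*Aa j τ+4)∧(∀ j τ, ‖X j τ‖≤Rw*√Γ → Aa j τ≤KA)∧(∀ j, Orthonormal ℝ ![deriv (X j) (c j), m j, n j] ∧ ⟪A j (m j), m j⟫_ℝ+⟪A j (n j), n j⟫_ℝ < 0 ∧ ⟪A j (n j), m j⟫_ℝ * ⟪A j (m j), n j⟫_ℝ < ⟪A j (m j), m j⟫_ℝ * ⟪A j (n j), n j⟫_ℝ)∧(∀ Y:Fin N → ℝ → EuclideanSpace ℝ (Fin 3), (∀ j, ContDiff ℝ 2 (Y j))→(∀ j τ, ⟪Y j τ, deriv (X j) τ⟫_ℝ = 0) → (∀ j τ, Rb*√(Γ*Real.log Γ) < ‖X j τ‖ → Y j τ = 0) → ∑ j, ⟪Y j (c j), cross (EuclideanSpace.single 2 1)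 (X j (c j))⟫_ℝ = 0 → (∀ j τ, ‖Y j τ‖+‖deriv (Y j) τ‖+‖iteratedDeriv 2 (Y j) τ‖≤(1+|τ-c j|)^b) → ∀ L:ℝ, (∀ j τ, ‖deriv (fun s:ℝ => T (fun k σ => X k σ+s•Y k σ) j τ) 0‖≤L*(1+|τ-c j|)^a) → ∀ j τ, ‖Y j τ‖≤cnd*L*(1+|τ-c j|)^b))) → ∃ (α₁ C₀ M:ℝ) (U:EuclideanSpace ℝ (Fin 3) → EuclideanSpace ℝ (Fin 3)) (P:EuclideanSpace ℝ (Fin 3) → ℝ), (α₁ ≠ 0 ∧ U ≠ 0 ∧ ContDiff ℝ (⊤:ℕ∞) U ∧ ContDiff ℝ (⊤:ℕ∞) P ∧ VectorCalculus.IsDivFree U∧(∀ y, α₁•(cross (EuclideanSpace.single 2 1) (U y)-fderiv ℝ U y (cross (EuclideanSpace.single 2 1) y))+(1/2:ℝ)•U y+(1/2:ℝ)•fderiv ℝ U y y-(Laplacian.laplacian U) y+fderiv ℝ U y (U y)+gradient P y = 0)∧(∀ y, ‖U y‖≤C₀/(1+‖y‖))∧(∀ y, |P y|≤M)∧(∀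 y, ‖y‖≤Rw*√Γ → (∀ j τ, ρ*√Γ/4≤‖y-X j τ‖) → ‖U y-u X y‖≤η*√Γ)))

/-- glue (provable now, Variant A1F). -/
def Selection1AF : Prop :=
  SkeletonJ1F → TransverseReduction1AF → RssProfileExists

theorem selection1AF_proof : Selection1AF := by
  unfold Selection1AF
  intro hbox hred
  classical
  obtain ⟨N, δ, ρ, K, Λ, a, b, cnd, η, Rw, Rb, cg, θ₀, KA, Γ₂, hN, hδ, hρ, ha, _hcnd, hη, hRw, hRb, hcg, hθ₀, hbox⟩ :=
    hbox
  obtain ⟨Γ₁, hred⟩ := hred N δ ρ K Λ a b cnd η Rw Rb cg θ₀ KA hN hδ hρ ha hη hRw hRb hcg hθ₀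
  obtain ⟨γ, α, X, w, c, m, n, Aa, hfam⟩ := hbox (max Γ₁ Γ₂) (le_max_right _ _)
  set Γ : ℝ := max Γ₁ Γ₂
  set u : (Fin N → ℝ → EuclideanSpace ℝ (Fin 3)) → EuclideanSpace ℝ (Fin 3) → EuclideanSpace ℝ (Fin 3) :=
    fun Z y => ∑ k : Fin N, (Γ * γ k / (4 * π)) • ∫ σ : ℝ,
        ((‖y - Z k σ‖ ^ 2 + Real.exp (-(1 + Real.eulerMascheroniConstant - Real.log 2)) * Aa k σ) ^ (3 / 2 : ℝ))⁻¹ •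
          cross (deriv (Z k) σ) (y - Z k σ)
  set v : EuclideanSpace ℝ (Fin 3) → EuclideanSpace ℝ (Fin 3) :=
    fun y => u X y + (1 / 2 : ℝ) • y - α • cross (EuclideanSpace.single (2 : Fin 3) (1 : ℝ)) y
  set A : Fin N → (EuclideanSpace ℝ (Fin 3) →L[ℝ] EuclideanSpace ℝ (Fin 3)) := fun j => fderiv ℝ v (X j (c j))
  set T : (Fin N → ℝ → EuclideanSpace ℝ (Fin 3)) → Fin N → ℝ → EuclideanSpace ℝ (Fin 3) :=
    fun Z j τ => (u Z (Z j τ) + (1 / 2 : ℝ) • Z j τ - α • cross (EuclideanSpace.single (2 : Fin 3) (1 : ℝ)) (Z j τ)) -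
      (inner ℝ (u Z (Z j τ) + (1 / 2 : ℝ) • Z j τ - α • cross (EuclideanSpace.single (2 : Fin 3) (1 : ℝ)) (Z j τ)) (deriv (Z j) τ) /
        ‖deriv (Z j) τ‖ ^ 2) • deriv (Z j) τ
  have hskel := hfam u v A T (fun _ _ => rfl) (fun _ => rfl) (fun _ => rfl) (fun _ _ _ => rfl)
  obtain ⟨α₁, C₀, M, U, P, hα₁, hU0, hUs, hPs, hdiv, heq, hdec, hPM, -⟩ := hred Γ (le_max_left _ _) γ α X w c m n Aa u v A T
    (fun _ _ => rfl) (fun _ => rfl) (fun _ => rfl) (fun _ _ _ => rfl) hskel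
  have heq0 : ∀ y : EuclideanSpace ℝ (Fin 3), α₁ • (rotGen (U y) - fderiv ℝ U y (rotGen y)) +
      (1 / 2 : ℝ) • U y + (1 / 2 : ℝ) • fderiv ℝ U y y - (Δ U) y + fderiv ℝ U y (U y) + gradient P y = 0 := by
    intro y
    simp only [splitGlue_rotGen_eq_cross_single_two]
    exact heq y
  exact stub_rssProfileExists_of_profile ⟨α₁, C₀, M, U, P, hα₁, hU0, hUs, hPs, hdiv, heq0, hdec, hPM⟩

theorem closes1AF (hSk : SkeletonJ1F) (hTR : TransverseReduction1AF) (hT : RdssProfileTruncation) :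
    ¬ _root_.NavierStokesRegularity := by
  obtain ⟨α, C₀, U, Rot, u, -, -, hU2, hU0, hu1, hrss, hmild, hmeas, hC⟩ := selection1AF_proof hSk hTR
  have hrdss : Literature.Analysis.FluidPDE.IsRotatedDSS 2 (Rot (-(α * (2 * Real.log 2)))) u := hrss 2 two_pos
  have hnz : ¬ (∀ t < 0, u t =ᵐ[volume] 0) := by
    intro h
    have h1 := h (-1) (by norm_num)
    rw [hu1] at h1
    exact hU0 ((Continuous.ae_eq_iff_eq volume hU2.continuous continuous_const).1 h1)
  obtain ⟨ν, hν, T, hT, v, q, ⟨hcl, hmax⟩, hLH, hdec⟩ := hT ⟨2, _, _, one_lt_two, hmild, hmeas, hrdss, ⟨C₀, hC⟩, hnz⟩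
  intro hA
  have h0 : (0 : ℝ) ∈ Set.Ico 0 T := ⟨le_rfl, hT⟩
  obtain ⟨u', p', hu', hp', hns, hbe⟩ := hA ν hν (v 0) (hcl.contDiff_velocity h0) (hcl.divFree 0 h0) hdec
  have heq : ∀ t ∈ Set.Ico 0 T, u' t = v t :=
    _root_.Summit.NavierStokesRegularity.NavierStokesRegularity.Theorems.blowup_clay_uniqueness
      ν hν (v 0) hdec u' v p' q T hT hu' hp' hns hbe hcl hLH rfl
  have hcl' : Literature.Analysis.FluidPDE.IsClassicalNSSolutionOn (Set.Ici 0) ν 0 u' p' :=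
    ⟨hu', hp', fun t ht x => hns.momentum t ht x, fun t ht => hns.divFree t ht⟩
  refine hmax ⟨T + 1, by linarith, u', p', ?_, heq⟩
  exact hcl'.mono (fun t ht => ht.1) (uniqueDiffOn_Ico 0 (T + 1))


/-! ## VARIANT A1G (rev 3.2, 2026-08-28) — A1α plus the Γ-flat ALL-τ core bound proposed by the tenure planner (repair-plan g11, 12:35:40Z)
One constant `KA` and ONE clause after (d7) on both sides: `(∀ j τ, Rw^2*Γ*Aa j τ ≤ KA*(Rw^2*Γ+‖X j τ‖^2))` — in scaled variables
A(ŝ) ≤ KA·(1 + ‖X̂‖²/Rw²): in-ball ⇒ Aa ≤ 2KA (so A1G ⇒ A1F with 2KA); for all τ ⇒ cone half-angle μ/√(‖X‖²+Rw²Γ) ≤ 0.6427√KA/(Rw√Γ) → 0;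
quadratic growth along frame-relaxed arms (A ~ C·ŝ²) is admitted; no numeric design threshold; junk-free (no division). Endorsed by the kit author
over A1F: it also controls the annulus Rw√Γ ≤ ‖X‖ ≤ Rb√(Γ log Γ) where 27414 uses tangency and the kernel (closes the «w near-stalls next to the
ball» residual of A1F) at no real cost to the skeleton prover. -/

/-- crux (rank 2, Variant A1G): SkeletonJ1 + Γ-flat all-τ core-area bound, extra constant KA. -/
def SkeletonJ1G : Prop :=
(open Literature.Analysis.FluidPDE in ∃ (N:ℕ) (δ ρ K Λ a b cnd η Rw Rb cg θ₀ KA Γ₂:ℝ), 0 < N ∧ 0 < δ ∧ 0 < ρ ∧ 0 ≤ a ∧ 0 < cnd ∧ 0 < η ∧ 0 < Rw ∧ 0 < Rb ∧ 0 < cg ∧ 0 < θ₀ ∧ ∀ Γ:ℝ, Γ₂≤Γ → ∃ (γ:Fin N → ℝ) (α:ℝ) (X:Fin N → ℝ → EuclideanSpace ℝ (Fin 3)) (w:Fin N → ℝ → ℝ) (c:Fin N → ℝ) (m n:Fin N → EuclideanSpace ℝ (Fin 3)) (Aa:Fin N → ℝ → ℝ), ∀ (u:(Fin N → ℝ → EuclideanSpace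 ℝ (Fin 3)) → EuclideanSpace ℝ (Fin 3) → EuclideanSpace ℝ (Fin 3)) (v:EuclideanSpace ℝ (Fin 3) → EuclideanSpace ℝ (Fin 3)) (A:Fin N → (EuclideanSpace ℝ (Fin 3) →L[ℝ] EuclideanSpace ℝ (Fin 3))) (T:(Fin N → ℝ → EuclideanSpace ℝ (Fin 3)) → Fin N → ℝ → EuclideanSpace ℝ (Fin 3)), (∀ Z y, u Z y = ∑ k, (Γ*γ k/(4*Real.pi))•∫ σ:ℝ, ((‖y-Z k σ‖^2+Real.exp (-(1+Real.eulerMascheroniConstant-Real.log 2))*Aa k σ)^(3/2:ℝ))⁻¹•cross (deriv (Z k) σ) (y-Z k σ))→(∀ y, v y = u X y+(1/2:ℝ)•y-α•cross (EuclideanSpace.single 2 1) y)→(∀ j, A j = fderiv ℝ v (X j (c j)))→(∀ Z j τ, T Z j τ = (u Z (Z j τ)+(1/2:ℝ)•Z j τ-α•cross (EuclideanSpace.single 2 1) (Z j τ))-(⟪u Z (Z j τ)+(1/2:ℝ)•Z j τ-α•cross (EuclideanSpace.single 2 1) (Z j τ), deriv (Z j) τ⟫_ℝ/‖deriv (Z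 j) τ‖^2)•deriv (Z j) τ)→((α ≠ 0 ∧ (∀ j, γ j ≠ 0)∧(∀ j, ContDiff ℝ 2 (X j) ∧ Differentiable ℝ (w j)∧(∀ τ, ‖deriv (X j) τ‖ = 1)∧(∀ τ, ‖iteratedDeriv 2 (X j) τ‖*√Γ≤K) ∧ Tendsto (fun τ => ‖X j τ‖) (cocompact ℝ) atTop)∧(∀ j k, j ≠ k → ∀ τ σ, ρ*√Γ≤‖X j τ-X k σ‖)∧(∀ j τ σ, ρ*√Γ≤|τ-σ| → cg*ρ*√Γ≤‖X j τ-X j σ‖)∧(∀ j τ, cg*|τ-c j|≤Rw*√Γ+‖X j τ‖)∧(∀ j τ, w j τ = ⟪v (X j τ), deriv (X j) τ⟫_ℝ)∧(∀ j τ, ‖X j τ‖≤Rb*√(Γ*Real.log Γ) → v (X j τ) = w j τ•deriv (X j) τ)∧(∀ j, ‖X j (c j)‖≤Rw*√Γ)∧(∀ j, |⟪deriv (X j) (c j), EuclideanSpace.single 2 1⟫_ℝ|≤1-θ₀)∧(θ₀≤|α| ∧ |α|≤θ₀⁻¹ ∧ ∀ j, θ₀≤|γ j| ∧ |γ j|≤θ₀⁻¹)∧(∀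 j, w j (c j) = 0 ∧ (∀ τ, w j τ = 0 → τ = c j) ∧ 3/2+δ≤deriv (w j) (c j) ∧ deriv (w j) (c j)≤Λ)∧(∀ j, Differentiable ℝ (Aa j) ∧ (∀ τ, 0 < Aa j τ) ∧ ∀ τ, w j τ*deriv (Aa j) τ = (3/2-deriv (w j) τ)*Aa j τ+4)∧(∀ j τ, Rw^2*Γ*Aa j τ≤KA*(Rw^2*Γ+‖X j τ‖^2))∧(∀ j, Orthonormal ℝ ![deriv (X j) (c j), m j, n j] ∧ ⟪A j (m j), m j⟫_ℝ+⟪A j (n j), n j⟫_ℝ < 0 ∧ ⟪A j (n j), m j⟫_ℝ * ⟪A j (m j), n j⟫_ℝ < ⟪A j (m j), m j⟫_ℝ * ⟪A j (n j), n j⟫_ℝ)∧(∀ Y:Fin N → ℝ → EuclideanSpace ℝ (Fin 3), (∀ j, ContDiff ℝ 2 (Y j))→(∀ j τ, ⟪Y j τ, deriv (X j) τ⟫_ℝ = 0) → (∀ j τ, Rb*√(Γ*Real.log Γ) < ‖X j τ‖ → Y j τ = 0) → ∑ j, ⟪Y j (c j), cross (EuclideanSpace.single 2 1) (X j (c j))⟫_ℝ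 = 0 → (∀ j τ, ‖Y j τ‖+‖deriv (Y j) τ‖+‖iteratedDeriv 2 (Y j) τ‖≤(1+|τ-c j|)^b) → ∀ L:ℝ, (∀ j τ, ‖deriv (fun s:ℝ => T (fun k σ => X k σ+s•Y k σ) j τ) 0‖≤L*(1+|τ-c j|)^a) → ∀ j τ, ‖Y j τ‖≤cnd*L*(1+|τ-c j|)^b))))

/-- crux (rank 3, Variant A1G): TransverseReduction1A with the Γ-flat all-τ bound among the skeleton hypotheses (∀ KA). -/
def TransverseReduction1AG : Prop :=
(open Literature.Analysis.FluidPDE in ∀ (N:ℕ) (δ ρ K Λ a b cnd η Rw Rb cg θ₀ KA:ℝ), 0 < N → 0 < δ → 0 < ρ → 0 ≤ a → 0 < η → 0 < Rw → 0 < Rb → 0 < cg → 0 < θ₀ → ∃ Γ₁:ℝ, ∀ Γ:ℝ, Γ₁≤Γ → ∀ (γ:Fin N → ℝ) (α:ℝ) (X:Fin N → ℝ → EuclideanSpace ℝ (Fin 3)) (w:Fin N → ℝ → ℝ) (c:Fin N → ℝ) (m n:Fin N → EuclideanSpace ℝ (Fin 3)) (Aa:Fin N → ℝ → ℝ) (u:(Fin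 N → ℝ → EuclideanSpace ℝ (Fin 3)) → EuclideanSpace ℝ (Fin 3) → EuclideanSpace ℝ (Fin 3)) (v:EuclideanSpace ℝ (Fin 3) → EuclideanSpace ℝ (Fin 3)) (A:Fin N → (EuclideanSpace ℝ (Fin 3) →L[ℝ] EuclideanSpace ℝ (Fin 3))) (T:(Fin N → ℝ → EuclideanSpace ℝ (Fin 3)) → Fin N → ℝ → EuclideanSpace ℝ (Fin 3)), (∀ Z y, u Z y = ∑ k, (Γ*γ k/(4*Real.pi))•∫ σ:ℝ, ((‖y-Z k σ‖^2+Real.exp (-(1+Real.eulerMascheroniConstant-Real.log 2))*Aa k σ)^(3/2:ℝ))⁻¹•cross (deriv (Z k) σ) (y-Z k σ))→(∀ y, v y = u X y+(1/2:ℝ)•y-α•cross (EuclideanSpace.single 2 1) y)→(∀ j, A j = fderiv ℝ v (X j (c j)))→(∀ Z j τ, T Z j τ = (u Z (Z j τ)+(1/2:ℝ)•Z j τ-α•cross (EuclideanSpace.single 2 1) (Z j τ))-(⟪u Z (Z j τ)+(1/2:ℝ)•Z j τ-α•cross (EuclideanSpace.single 2 1) (Z j τ), deriv (Z j) τ⟫_ℝ/‖deriv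 (Z j) τ‖^2)•deriv (Z j) τ)→((α ≠ 0 ∧ (∀ j, γ j ≠ 0)∧(∀ j, ContDiff ℝ 2 (X j) ∧ Differentiable ℝ (w j)∧(∀ τ, ‖deriv (X j) τ‖ = 1)∧(∀ τ, ‖iteratedDeriv 2 (X j) τ‖*√Γ≤K) ∧ Tendsto (fun τ => ‖X j τ‖) (cocompact ℝ) atTop)∧(∀ j k, j ≠ k → ∀ τ σ, ρ*√Γ≤‖X j τ-X k σ‖)∧(∀ j τ σ, ρ*√Γ≤|τ-σ| → cg*ρ*√Γ≤‖X j τ-X j σ‖)∧(∀ j τ, cg*|τ-c j|≤Rw*√Γ+‖X j τ‖)∧(∀ j τ, w j τ = ⟪v (X j τ), deriv (X j) τ⟫_ℝ)∧(∀ j τ, ‖X j τ‖≤Rb*√(Γ*Real.log Γ) → v (X j τ) = w j τ•deriv (X j) τ)∧(∀ j, ‖X j (c j)‖≤Rw*√Γ)∧(∀ j, |⟪deriv (X j) (c j), EuclideanSpace.single 2 1⟫_ℝ|≤1-θ₀)∧(θ₀≤|α| ∧ |α|≤θ₀⁻¹ ∧ ∀ j, θ₀≤|γ j| ∧ |γ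 j|≤θ₀⁻¹)∧(∀ j, w j (c j) = 0 ∧ (∀ τ, w j τ = 0 → τ = c j) ∧ 3/2+δ≤deriv (w j) (c j) ∧ deriv (w j) (c j)≤Λ)∧(∀ j, Differentiable ℝ (Aa j) ∧ (∀ τ, 0 < Aa j τ) ∧ ∀ τ, w j τ*deriv (Aa j) τ = (3/2-deriv (w j) τ)*Aa j τ+4)∧(∀ j τ, Rw^2*Γ*Aa j τ≤KA*(Rw^2*Γ+‖X j τ‖^2))∧(∀ j, Orthonormal ℝ ![deriv (X j) (c j), m j, n j] ∧ ⟪A j (m j), m j⟫_ℝ+⟪A j (n j), n j⟫_ℝ < 0 ∧ ⟪A j (n j), m j⟫_ℝ * ⟪A j (m j), n j⟫_ℝ < ⟪A j (m j), m j⟫_ℝ * ⟪A j (n j), n j⟫_ℝ)∧(∀ Y:Fin N → ℝ → EuclideanSpace ℝ (Fin 3), (∀ j, ContDiff ℝ 2 (Y j))→(∀ j τ, ⟪Y j τ, deriv (X j) τ⟫_ℝ = 0) → (∀ j τ, Rb*√(Γ*Real.log Γ) < ‖X j τ‖ → Y j τ = 0) → ∑ j, ⟪Y j (c j), cross (EuclideanSpace.single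 2 1) (X j (c j))⟫_ℝ = 0 → (∀ j τ, ‖Y j τ‖+‖deriv (Y j) τ‖+‖iteratedDeriv 2 (Y j) τ‖≤(1+|τ-c j|)^b) → ∀ L:ℝ, (∀ j τ, ‖deriv (fun s:ℝ => T (fun k σ => X k σ+s•Y k σ) j τ) 0‖≤L*(1+|τ-c j|)^a) → ∀ j τ, ‖Y j τ‖≤cnd*L*(1+|τ-c j|)^b))) → ∃ (α₁ C₀ M:ℝ) (U:EuclideanSpace ℝ (Fin 3) → EuclideanSpace ℝ (Fin 3)) (P:EuclideanSpace ℝ (Fin 3) → ℝ), (α₁ ≠ 0 ∧ U ≠ 0 ∧ ContDiff ℝ (⊤:ℕ∞) U ∧ ContDiff ℝ (⊤:ℕ∞) P ∧ VectorCalculus.IsDivFree U∧(∀ y, α₁•(cross (EuclideanSpace.single 2 1) (U y)-fderiv ℝ U y (cross (EuclideanSpace.single 2 1) y))+(1/2:ℝ)•U y+(1/2:ℝ)•fderiv ℝ U y y-(Laplacian.laplacian U) y+fderiv ℝ U y (U y)+gradient P y = 0)∧(∀ y, ‖U y‖≤C₀/(1+‖y‖))∧(∀ y, |P y|≤M)∧(∀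 y, ‖y‖≤Rw*√Γ → (∀ j τ, ρ*√Γ/4≤‖y-X j τ‖) → ‖U y-u X y‖≤η*√Γ)))

/-- glue (provable now, Variant A1G). -/
def Selection1AG : Prop :=
  SkeletonJ1G → TransverseReduction1AG → RssProfileExists

theorem selection1AG_proof : Selection1AG := by
  unfold Selection1AG
  intro hbox hred
  classical
  obtain ⟨N, δ, ρ, K, Λ, a, b, cnd, η, Rw, Rb, cg, θ₀, KA, Γ₂, hN, hδ, hρ, ha, _hcnd, hη, hRw, hRb, hcg, hθ₀, hbox⟩ :=
    hbox
  obtain ⟨Γ₁, hred⟩ := hred N δ ρ K Λ a b cnd η Rw Rb cg θ₀ KA hN hδ hρ ha hη hRw hRb hcg hθ₀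
  obtain ⟨γ, α, X, w, c, m, n, Aa, hfam⟩ := hbox (max Γ₁ Γ₂) (le_max_right _ _)
  set Γ : ℝ := max Γ₁ Γ₂
  set u : (Fin N → ℝ → EuclideanSpace ℝ (Fin 3)) → EuclideanSpace ℝ (Fin 3) → EuclideanSpace ℝ (Fin 3) :=
    fun Z y => ∑ k : Fin N, (Γ * γ k / (4 * π)) • ∫ σ : ℝ,
        ((‖y - Z k σ‖ ^ 2 + Real.exp (-(1 + Real.eulerMascheroniConstant - Real.log 2)) * Aa k σ) ^ (3 / 2 : ℝ))⁻¹ •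
          cross (deriv (Z k) σ) (y - Z k σ)
  set v : EuclideanSpace ℝ (Fin 3) → EuclideanSpace ℝ (Fin 3) :=
    fun y => u X y + (1 / 2 : ℝ) • y - α • cross (EuclideanSpace.single (2 : Fin 3) (1 : ℝ)) y
  set A : Fin N → (EuclideanSpace ℝ (Fin 3) →L[ℝ] EuclideanSpace ℝ (Fin 3)) := fun j => fderiv ℝ v (X j (c j))
  set T : (Fin N → ℝ → EuclideanSpace ℝ (Fin 3)) → Fin N → ℝ → EuclideanSpace ℝ (Fin 3) :=
    fun Z j τ => (u Z (Z j τ) + (1 / 2 : ℝ) • Z j τ - α • cross (EuclideanSpace.single (2 : Fin 3) (1 : ℝ)) (Z j τ)) -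
      (inner ℝ (u Z (Z j τ) + (1 / 2 : ℝ) • Z j τ - α • cross (EuclideanSpace.single (2 : Fin 3) (1 : ℝ)) (Z j τ)) (deriv (Z j) τ) /
        ‖deriv (Z j) τ‖ ^ 2) • deriv (Z j) τ
  have hskel := hfam u v A T (fun _ _ => rfl) (fun _ => rfl) (fun _ => rfl) (fun _ _ _ => rfl)
  obtain ⟨α₁, C₀, M, U, P, hα₁, hU0, hUs, hPs, hdiv, heq, hdec, hPM, -⟩ := hred Γ (le_max_left _ _) γ α X w c m n Aa u v A T
    (fun _ _ => rfl) (fun _ => rfl) (fun _ => rfl) (fun _ _ _ => rfl) hskel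
  have heq0 : ∀ y : EuclideanSpace ℝ (Fin 3), α₁ • (rotGen (U y) - fderiv ℝ U y (rotGen y)) +
      (1 / 2 : ℝ) • U y + (1 / 2 : ℝ) • fderiv ℝ U y y - (Δ U) y + fderiv ℝ U y (U y) + gradient P y = 0 := by
    intro y
    simp only [splitGlue_rotGen_eq_cross_single_two]
    exact heq y
  exact stub_rssProfileExists_of_profile ⟨α₁, C₀, M, U, P, hα₁, hU0, hUs, hPs, hdiv, heq0, hdec, hPM⟩

theorem closes1AG (hSk : SkeletonJ1G) (hTR : TransverseReduction1AG) (hT : RdssProfileTruncation) :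
    ¬ _root_.NavierStokesRegularity := by
  obtain ⟨α, C₀, U, Rot, u, -, -, hU2, hU0, hu1, hrss, hmild, hmeas, hC⟩ := selection1AG_proof hSk hTR
  have hrdss : Literature.Analysis.FluidPDE.IsRotatedDSS 2 (Rot (-(α * (2 * Real.log 2)))) u := hrss 2 two_pos
  have hnz : ¬ (∀ t < 0, u t =ᵐ[volume] 0) := by
    intro h
    have h1 := h (-1) (by norm_num)
    rw [hu1] at h1
    exact hU0 ((Continuous.ae_eq_iff_eq volume hU2.continuous continuous_const).1 h1)
  obtain ⟨ν, hν, T, hT, v, q, ⟨hcl, hmax⟩, hLH, hdec⟩ := hT ⟨2, _, _, one_lt_two, hmild, hmeas, hrdss, ⟨C₀, hC⟩, hnz⟩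
  intro hA
  have h0 : (0 : ℝ) ∈ Set.Ico 0 T := ⟨le_rfl, hT⟩
  obtain ⟨u', p', hu', hp', hns, hbe⟩ := hA ν hν (v 0) (hcl.contDiff_velocity h0) (hcl.divFree 0 h0) hdec
  have heq : ∀ t ∈ Set.Ico 0 T, u' t = v t :=
    _root_.Summit.NavierStokesRegularity.NavierStokesRegularity.Theorems.blowup_clay_uniqueness
      ν hν (v 0) hdec u' v p' q T hT hu' hp' hns hbe hcl hLH rfl
  have hcl' : Literature.Analysis.FluidPDE.IsClassicalNSSolutionOn (Set.Ici 0) ν 0 u' p' :=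
    ⟨hu', hp', fun t ht x => hns.momentum t ht x, fun t ht => hns.divFree t ht⟩
  refine hmax ⟨T + 1, by linarith, u', p', ?_, heq⟩
  exact hcl'.mono (fun t ht => ht.1) (uniqueDiffOn_Ico 0 (T + 1))



end Summit.NavierStokesRegularity.NavierStokesRegularity.Cruxes.SelectionBoxRJ.RetypeKit
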